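import Mathlib.MeasureTheory.Integral.DominatedConvergence
import Mathlib.MeasureTheory.Integral.Prod
import Literature.MathematicalPhysics.KineticTheory.LorentzGasGallavotti
import Literature.MathematicalPhysics.KineticTheory.LinearLorentzBoltzmannProofs
import HarnessLib

/-!
# Duality of the forward and backward collision series (discharge of F3b)
(trunk T-KINETIC; topic MathematicalPhysics/KineticTheory; proofs for
`Literature.MathematicalPhysics.KineticTheory.LorentzGasGallavotti`)

This file discharges the named fact `Kinetic.lorentzSeries_duality` (F3b of the decomposition of
`Hilbert6.gallavotti_spohn_lorentz`): for `σ ≥ 0`, `t ≥ 0`, a continuous bounded integrable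
datum `f₀ ≥ 0` and a bounded continuous observable `φ` on `ℝ^d × ℝ^d`,
`∫ φ(z) (∑ₙ uₙ)(t, z) dz = ∫ f₀(z) (∑ₙ wₙ)(t, z) dz`, where `∑ₙ uₙ = Kinetic.lorentzSeriesSolution`
is the forward (density) collision series and `∑ₙ wₙ = Kinetic.lorentzDualSeries` the backward
(observable) one. Main result: `Kinetic.lorentzSeries_duality_holds`. With the accepted
`Hilbert6.gallavotti_spohn_lorentz_of_dual` (`ShortRangePotentialsProofs`) this leaves the
a.e. convergence of the transition expectations, `Hilbert6.gallavotti_lorentz_tendsto_dual`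
(F3a), as the only open input of `Hilbert6.gallavotti_spohn_lorentz`.

## Proof

Everything is first done for the `ℝ≥0∞`-valued mirrors `Kinetic.lorentzSeriesTermENN`,
`Kinetic.lorentzDualTermENN` of `LorentzGasGallavotti`, where Tonelli needs no integrability:

* `Hilbert6.measurePreserving_restrict_sphere`: the surface measure `Hilbert6.sphereMeasure =
  volume.toSphere` is invariant under every linear isometry (the cone over `A⁻¹' s` is `A⁻¹'` of
  the cone over `s`); hence the loss frequency is isotropic (`Kinetic.lorentzLossRate_isometry`,
  `_reflect`, `_neg`) and the gain operator is covariant (`Kinetic.lorentzGainOp_isometry`).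
* `Kinetic.lintegral_mul_lorentzGainOpENN`: the gain operator is self-adjoint on `ℝ≥0∞`-valued
  functions — swap `v` and `ω`, substitute the reflection `v ↦ v - 2(v·ω)ω` (Lebesgue-measure
  preserving involution flipping the sign of `v·ω`), then the antipodal map `ω ↦ -ω` (which
  preserves the surface measure and the reflection). `Kinetic.lintegral_transport_adjoint`:
  damped free transport `x ↦ x - τv` is the adjoint of `x ↦ x + τv` (Liouville).
* `Kinetic.lorentzDualTermENN_succ_eq_last`: the backward recursion peels off the FIRST
  collision while the forward recursion peels off the LAST one; the two `(n+1)`-fold path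
  integrals are re-associated by Tonelli on the time triangle (`Kinetic.lintegral_triangle_shear`,
  the shear `(q, s') ↦ (q, s' - q)`), giving the last-collision form of `w_{n+1}`.
* `Kinetic.lintegral_mul_lorentzSeriesTermENN`: termwise duality `∫⁻ ψ uₙ'(t) = ∫⁻ wₙ'(t) f₀` for
  all measurable `ψ, f₀ ≥ 0`, by induction on `n` from the three previous items (joint
  measurability of the mirrors in all parameters: `Kinetic.measurable_lorentzDualTermENN_param`,
  `Kinetic.measurable_lorentzSeriesTermENN_param`).

Then the real statement is recovered:

* `Kinetic.continuous_lorentzDualTerm`, `Kinetic.abs_lorentzDualTerm_le` (the sharp bound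
  `|wₙ(t, x, v)| ≤ ‖ψ‖_∞ e^{-σν(v)t} (σν(v)t)ⁿ/n!`, using `ν(v - 2(v·ω)ω) = ν(v)`), whence
  `∑ₙ |wₙ| ≤ ‖ψ‖_∞` (`Kinetic.abs_lorentzDualSeries_le`, Poisson probabilities sum to one,
  Mathlib's `ProbabilityTheory.hasSum_one_poissonMeasure`) and linearity in the observable
  (`Kinetic.lorentzDualTerm_sub`, `Kinetic.lorentzDualSeries_sub`);
* `Kinetic.ofReal_lorentzSeriesTerm`, `Kinetic.ofReal_lorentzDualTerm`: for nonnegative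
  continuous data the mirrors are `ENNReal.ofReal` of the real terms (`t ≥ 0`, `σ ≥ 0`);
* `Kinetic.integral_mul_lorentzSeriesSolution_of_nonneg`: duality and integrability of both
  sides for a nonnegative observable (`ENNReal.ofReal_tsum_of_nonneg`, `lintegral_tsum`, the
  `ℝ≥0∞` duality, and the bound `∑ₙ wₙ ≤ C` for finiteness), and finally
  `Kinetic.lorentzSeries_duality_holds` by splitting `φ = φ⁺ - φ⁻`.

## References

* H. Spohn, *The Lorentz process converges to a random flight process*, Comm. Math. Phys. 60
  (1978) 277–290, §3 (the semigroup `U_t`) and Thm 3.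
* H. Spohn, *Large Scale Dynamics of Interacting Particles*, Springer (1991), proof of Thm. 8.8,
  (8.127).
-/

open MeasureTheory Metric Real Set Filter Topology
open scoped InnerProductSpace ENNReal Pointwise

namespace Literature.MathematicalPhysics.KineticTheory

noncomputable section

/-! ## Invariance of the sphere measure under linear isometries -/

section Hilbert6

variable {E : Type*} [NormedAddCommGroup E] [InnerProductSpace ℝ E] [FiniteDimensional ℝ E]
  [MeasurableSpace E] [BorelSpace E]

omit [FiniteDimensional ℝ E] [MeasurableSpace E] [BorelSpace E] in
/-- A linear isometry maps the unit sphere to itself. [folklore] -/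
theorem mapsTo_sphere_linearIsometryEquiv (A : E ≃ₗᵢ[ℝ] E) :
    MapsTo A (sphere (0 : E) 1) (sphere (0 : E) 1) := fun ω hω => by
  simpa [mem_sphere_zero_iff_norm] using hω

omit [FiniteDimensional ℝ E] [MeasurableSpace E] [BorelSpace E] in
/-- The restriction of a linear isometry to the unit sphere is continuous. [folklore] -/
theorem continuous_restrict_sphere (A : E ≃ₗᵢ[ℝ] E) :
    Continuous ((mapsTo_sphere_linearIsometryEquiv A).restrict A (sphere (0 : E) 1)
      (sphere (0 : E) 1)) :=
  (A.continuous.comp continuous_subtype_val).subtype_mk _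

omit [FiniteDimensional ℝ E] [MeasurableSpace E] [BorelSpace E] in
/-- The restriction of a linear isometry to the unit sphere is injective. [folklore] -/
theorem injective_restrict_sphere (A : E ≃ₗᵢ[ℝ] E) :
    Function.Injective ((mapsTo_sphere_linearIsometryEquiv A).restrict A (sphere (0 : E) 1)
      (sphere (0 : E) 1)) := fun ω ω' h => by
  apply Subtype.ext
  have := congrArg Subtype.val h
  simpa [MapsTo.val_restrict_apply] using this

/-- The restriction of a linear isometry to the unit sphere is a measurable embedding (a closed
embedding of a compact space). [folklore] -/
theorem measurableEmbedding_restrict_sphere (A : E ≃ₗᵢ[ℝ] E) :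
    MeasurableEmbedding ((mapsTo_sphere_linearIsometryEquiv A).restrict A (sphere (0 : E) 1)
      (sphere (0 : E) 1)) :=
  ((continuous_restrict_sphere A).isClosedEmbedding
    (injective_restrict_sphere A)).measurableEmbedding

/-- **The surface measure is invariant under linear isometries**: for `A : E ≃ₗᵢ[ℝ] E`, the
induced map of the unit sphere preserves `Hilbert6.sphereMeasure = volume.toSphere` (the cone
over `A⁻¹' s` is `A⁻¹'` of the cone over `s`, and `A` preserves Lebesgue measure,
`LinearIsometryEquiv.measurePreserving`). [folklore] -/
theorem measurePreserving_restrict_sphere (A : E ≃ₗᵢ[ℝ] E) :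
    MeasurePreserving ((mapsTo_sphere_linearIsometryEquiv A).restrict A (sphere (0 : E) 1)
      (sphere (0 : E) 1)) sphereMeasure sphereMeasure := by
  set f := (mapsTo_sphere_linearIsometryEquiv A).restrict A (sphere (0 : E) 1) (sphere (0 : E) 1)
    with hf
  have hfm : Measurable f := (continuous_restrict_sphere A).measurable
  refine ⟨hfm, Measure.ext fun s hs => ?_⟩
  rw [Measure.map_apply hfm hs]
  unfold sphereMeasure
  rw [Measure.toSphere_apply' _ (hfm hs), Measure.toSphere_apply' _ hs]
  congr 1
  have himg : ((↑) : sphere (0 : E) 1 → E) '' (f ⁻¹' s) = A ⁻¹' (((↑) : sphere (0 : E) 1 → E) '' s) := by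
    ext y
    simp only [mem_image, mem_preimage]
    constructor
    · rintro ⟨ω, hω, rfl⟩
      exact ⟨f ω, hω, rfl⟩
    · rintro ⟨ω', hω', hy⟩
      have hy1 : ‖y‖ = 1 := by
        have := congrArg norm hy
        rw [norm_eq_of_mem_sphere ω'] at this
        simpa [A.norm_map] using this.symm
      refine ⟨⟨y, mem_sphere_zero_iff_norm.2 hy1⟩, ?_, rfl⟩
      have : f ⟨y, mem_sphere_zero_iff_norm.2 hy1⟩ = ω' := Subtype.ext (by simpa [hf] using hy.symm)
      rwa [this]
  have hsmul : Ioo (0 : ℝ) 1 • (A ⁻¹' (((↑) : sphere (0 : E) 1 → E) '' s)) =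
      A ⁻¹' (Ioo (0 : ℝ) 1 • (((↑) : sphere (0 : E) 1 → E) '' s)) := by
    ext z
    simp only [Set.mem_smul, mem_preimage]
    constructor
    · rintro ⟨r, hr, y, hy, rfl⟩
      exact ⟨r, hr, A y, hy, by simp⟩
    · rintro ⟨r, hr, w, hw, hz⟩
      refine ⟨r, hr, A.symm w, by simpa using hw, ?_⟩
      apply A.injective
      simp [hz]
  rw [himg, hsmul]
  exact (A.measurePreserving.measure_preimage_emb A.toHomeomorph.measurableEmbedding _)

/-- Substitution rule on the sphere for a linear isometry: `∫ F(A ω) dω = ∫ F(ω) dω`. [folklore] -/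
theorem integral_sphere_comp_isometry {G : Type*} [NormedAddCommGroup G] [NormedSpace ℝ G]
    (A : E ≃ₗᵢ[ℝ] E) (F : sphere (0 : E) 1 → G) :
    ∫ ω, F ((mapsTo_sphere_linearIsometryEquiv A).restrict A (sphere (0 : E) 1)
      (sphere (0 : E) 1) ω) ∂sphereMeasure = ∫ ω, F ω ∂sphereMeasure :=
  (measurePreserving_restrict_sphere A).integral_comp (measurableEmbedding_restrict_sphere A) F

omit [FiniteDimensional ℝ E] [MeasurableSpace E] [BorelSpace E] in
/-- For a unit vector `ω`, the reflection in the hyperplane `ω^⊥` is `v ↦ v - 2(v·ω)ω`.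
[folklore] -/
theorem reflection_orthogonal_sphere_apply (ω : sphere (0 : E) 1) (v : E) :
    (ℝ ∙ (ω : E))ᗮ.reflection v = v - (2 * ⟪v, (ω : E)⟫_ℝ) • (ω : E) := by
  rw [Submodule.reflection_orthogonal_apply, Submodule.reflection_singleton_apply,
    norm_eq_of_mem_sphere ω, neg_sub, real_inner_comm]
  simp only [RCLike.ofReal_real_eq_id, id_eq, one_pow, div_one]
  congr 1
  rw [two_smul, two_mul, add_smul]

end Hilbert6

section Kinetic

variable {E : Type*} [NormedAddCommGroup E] [InnerProductSpace ℝ E] [FiniteDimensional ℝ E]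
  [MeasurableSpace E] [BorelSpace E]

/-- **The loss frequency is isotropic**: `ν(A v) = ν(v)` for every linear isometry `A` (it only
depends on the speed). [folklore] -/
theorem lorentzLossRate_isometry (A : E ≃ₗᵢ[ℝ] E) (v : E) :
    lorentzLossRate (A v) = lorentzLossRate v := by
  unfold lorentzLossRate
  rw [← KineticTheory.integral_sphere_comp_isometry A (fun ω => max ⟪A v, (ω : E)⟫_ℝ 0)]
  congr 1
  funext ω
  simp [MapsTo.val_restrict_apply, LinearIsometryEquiv.inner_map_map]

/-- **Covariance of the gain operator**: `(L⁺ g)(A v) = (L⁺ (g ∘ A))(v)` for a linear isometry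
`A`. [folklore] -/
theorem lorentzGainOp_isometry (A : E ≃ₗᵢ[ℝ] E) (g : E → ℝ) (v : E) :
    lorentzGainOp g (A v) = lorentzGainOp (g ∘ A) v := by
  unfold lorentzGainOp
  rw [← KineticTheory.integral_sphere_comp_isometry A
    (fun ω => max ⟪A v, (ω : E)⟫_ℝ 0 * g (A v - (2 * ⟪A v, (ω : E)⟫_ℝ) • (ω : E)))]
  congr 1
  funext ω
  simp [MapsTo.val_restrict_apply, LinearIsometryEquiv.inner_map_map, map_sub]

/-- The loss frequency is invariant under the velocity reflections `v ↦ v - 2(v·ω)ω` of the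
collision process (speed is conserved). [folklore] -/
theorem lorentzLossRate_reflect (v : E) (ω : sphere (0 : E) 1) :
    lorentzLossRate (v - (2 * ⟪v, (ω : E)⟫_ℝ) • (ω : E)) = lorentzLossRate v := by
  rw [← KineticTheory.reflection_orthogonal_sphere_apply]
  exact lorentzLossRate_isometry _ v

/-- The loss frequency is even: `ν(-v) = ν(v)`. [folklore] -/
theorem LinearLorentzBoltzmannDuality.lorentzLossRate_neg (v : E) : lorentzLossRate (-v) = lorentzLossRate v := by
  have := lorentzLossRate_isometry (LinearIsometryEquiv.neg ℝ (E := E)) v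
  simpa using this

end Kinetic

end

end Literature.MathematicalPhysics.KineticTheory

namespace Literature.MathematicalPhysics.KineticTheory

noncomputable section

section Kinetic

open MeasureTheory Metric Real Set Filter Topology
open scoped InnerProductSpace ENNReal Pointwise

/-! ## Measurability of the `ℝ≥0∞`-valued collision series -/

section GainENN

variable {E : Type*} [NormedAddCommGroup E] [InnerProductSpace ℝ E] [FiniteDimensional ℝ E]
  [MeasurableSpace E] [BorelSpace E]

/-- The hard-sphere kernel `(v, ω) ↦ (v·ω)₊` is measurable as an `ℝ≥0∞`-valued function.
[folklore] -/
theorem measurable_kernelENN :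
    Measurable fun p : E × sphere (0 : E) 1 => ENNReal.ofReal (max ⟪p.1, (p.2 : E)⟫_ℝ 0) :=
  ENNReal.measurable_ofReal.comp continuous_max_inner_zero.measurable

/-- The reflected velocity `(v, ω) ↦ v - 2(v·ω)ω` is measurable. [folklore] -/
theorem measurable_reflectVelocity :
    Measurable fun p : E × sphere (0 : E) 1 => p.1 - (2 * ⟪p.1, (p.2 : E)⟫_ℝ) • (p.2 : E) :=
  continuous_reflect_velocity.measurable

/-- **Parametric measurability of the `ℝ≥0∞` gain operator**: if `h a w` is jointly measurable
and `v a` measurable then `a ↦ (L⁺ (h a))(v a)` is measurable (Tonelli measurability of a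
parametric lower integral over the sphere). [folklore] -/
theorem measurable_lorentzGainOpENN_param {α : Type*} [MeasurableSpace α]
    {h : α → E → ℝ≥0∞} (hh : Measurable (Function.uncurry h)) {v : α → E} (hv : Measurable v) :
    Measurable fun a => lorentzGainOpENN (h a) (v a) := by
  have hvω : Measurable fun q : α × sphere (0 : E) 1 => (v q.1, q.2) :=
    (hv.comp measurable_fst).prodMk measurable_snd
  have hF : Measurable fun q : α × sphere (0 : E) 1 =>
      ENNReal.ofReal (max ⟪v q.1, ((q.2 : sphere (0 : E) 1) : E)⟫_ℝ 0) *
        h q.1 (v q.1 - (2 * ⟪v q.1, ((q.2 : sphere (0 : E) 1) : E)⟫_ℝ) •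
          ((q.2 : sphere (0 : E) 1) : E)) :=
    (measurable_kernelENN.comp hvω).mul
      (hh.comp (measurable_fst.prodMk (measurable_reflectVelocity.comp hvω)))
  exact hF.lintegral_prod_right'

/-- The `ℝ≥0∞` gain operator of a measurable function is measurable. [folklore] -/
theorem measurable_lorentzGainOpENN {g : E → ℝ≥0∞} (hg : Measurable g) :
    Measurable (lorentzGainOpENN g) :=
  measurable_lorentzGainOpENN_param (α := E) (h := fun _ => g) (hg.comp measurable_snd)
    measurable_id

/-- **Self-adjointness of the gain operator** (`ℝ≥0∞` form, Tonelli): for measurable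
`ψ, g : E → [0, ∞]`, `∫⁻ ψ · L⁺ g = ∫⁻ L⁺ ψ · g`. Mechanism: swap the `v`- and `ω`-integrals,
substitute `v ↦ v - 2(v·ω)ω` (a reflection, Lebesgue-measure preserving involution, which flips
the sign of `v·ω`), then `ω ↦ -ω` (which preserves the surface measure and the reflection).
[folklore] -/
theorem lintegral_mul_lorentzGainOpENN {ψ g : E → ℝ≥0∞} (hψ : Measurable ψ) (hg : Measurable g) :
    ∫⁻ v, ψ v * lorentzGainOpENN g v = ∫⁻ v, lorentzGainOpENN ψ v * g v := by
  -- notation-free abbreviations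
  have hk := (measurable_kernelENN (E := E))
  have hR := (measurable_reflectVelocity (E := E))
  -- Step 1: expand and swap (v, ω)
  have h1 : ∫⁻ v, ψ v * lorentzGainOpENN g v =
      ∫⁻ ω : sphere (0 : E) 1, ∫⁻ v, ψ v * (ENNReal.ofReal (max ⟪v, (ω : E)⟫_ℝ 0) *
        g (v - (2 * ⟪v, (ω : E)⟫_ℝ) • (ω : E))) ∂volume ∂KineticTheory.sphereMeasure := by
    simp only [lorentzGainOpENN]
    have : ∀ v, ψ v * ∫⁻ ω : sphere (0 : E) 1, ENNReal.ofReal (max ⟪v, (ω : E)⟫_ℝ 0) *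
        g (v - (2 * ⟪v, (ω : E)⟫_ℝ) • (ω : E)) ∂KineticTheory.sphereMeasure =
        ∫⁻ ω : sphere (0 : E) 1, ψ v * (ENNReal.ofReal (max ⟪v, (ω : E)⟫_ℝ 0) *
        g (v - (2 * ⟪v, (ω : E)⟫_ℝ) • (ω : E))) ∂KineticTheory.sphereMeasure := fun v =>
      (lintegral_const_mul _ ((hk.comp (measurable_const.prodMk measurable_id)).mul
        (hg.comp (hR.comp (measurable_const.prodMk measurable_id))))).symm
    simp_rw [this]
    exact lintegral_lintegral_swap (((hψ.comp measurable_fst).mul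
      (hk.mul (hg.comp hR))).aemeasurable)
  have h2 : ∫⁻ v, lorentzGainOpENN ψ v * g v =
      ∫⁻ ω : sphere (0 : E) 1, ∫⁻ v, (ENNReal.ofReal (max ⟪v, (ω : E)⟫_ℝ 0) *
        ψ (v - (2 * ⟪v, (ω : E)⟫_ℝ) • (ω : E))) * g v ∂volume ∂KineticTheory.sphereMeasure := by
    simp only [lorentzGainOpENN]
    have : ∀ v, (∫⁻ ω : sphere (0 : E) 1, ENNReal.ofReal (max ⟪v, (ω : E)⟫_ℝ 0) *
        ψ (v - (2 * ⟪v, (ω : E)⟫_ℝ) • (ω : E)) ∂KineticTheory.sphereMeasure) * g v =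
        ∫⁻ ω : sphere (0 : E) 1, (ENNReal.ofReal (max ⟪v, (ω : E)⟫_ℝ 0) *
        ψ (v - (2 * ⟪v, (ω : E)⟫_ℝ) • (ω : E))) * g v ∂KineticTheory.sphereMeasure := fun v =>
      (lintegral_mul_const _ ((hk.comp (measurable_const.prodMk measurable_id)).mul
        (hψ.comp (hR.comp (measurable_const.prodMk measurable_id))))).symm
    simp_rw [this]
    exact lintegral_lintegral_swap (((hk.mul (hψ.comp hR)).mul
      (hg.comp measurable_fst)).aemeasurable)
  rw [h1, h2]
  -- Step 2: ω ↦ -ω on the outside of the right-hand side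
  have hneg := KineticTheory.measurePreserving_restrict_sphere (LinearIsometryEquiv.neg ℝ (E := E))
  rw [← hneg.lintegral_comp_emb (KineticTheory.measurableEmbedding_restrict_sphere _)]
  refine lintegral_congr fun ω => ?_
  -- Step 3: v ↦ v - 2(v·ω)ω inside
  have hrefl := ((ℝ ∙ ((ω : sphere (0 : E) 1) : E))ᗮ.reflection).measurePreserving
  rw [← hrefl.lintegral_comp_emb
    ((ℝ ∙ ((ω : sphere (0 : E) 1) : E))ᗮ.reflection).toHomeomorph.measurableEmbedding]
  refine lintegral_congr fun v => ?_
  have hRv : (ℝ ∙ ((ω : sphere (0 : E) 1) : E))ᗮ.reflection v =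
      v - (2 * ⟪v, (ω : E)⟫_ℝ) • (ω : E) := KineticTheory.reflection_orthogonal_sphere_apply ω v
  have hω1 := KineticTheory.real_inner_self_sphere ω
  simp only [hRv, MapsTo.val_restrict_apply, LinearIsometryEquiv.coe_neg, inner_neg_right,
    inner_sub_left, inner_smul_left, hω1, RCLike.conj_to_real]
  -- remaining algebra: the reflected-twice velocity is `v`, and the kernels match
  have e1 : v - (2 * ⟪v, (ω : E)⟫_ℝ) • (ω : E) -
      (2 * -(⟪v, (ω : E)⟫_ℝ - 2 * ⟪v, (ω : E)⟫_ℝ * 1)) • -(ω : E) = v := by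
    rw [smul_neg, sub_neg_eq_add, mul_one]
    have : (2 * -(⟪v, (ω : E)⟫_ℝ - 2 * ⟪v, (ω : E)⟫_ℝ)) = 2 * ⟪v, (ω : E)⟫_ℝ := by ring
    rw [this, sub_add_cancel]
  have e2 : max (-(⟪v, (ω : E)⟫_ℝ - 2 * ⟪v, (ω : E)⟫_ℝ * 1)) 0 = max ⟪v, (ω : E)⟫_ℝ 0 := by
    congr 1; ring
  rw [e1, e2]
  ring

end GainENN

section ENNMeasurability

variable {d : Type*} [Fintype d]


/-- Measurability of a lower integral over the parameter-dependent time interval `(0, b a]`.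
[folklore] -/
theorem measurable_setLIntegral_Ioc_param {α : Type*} [MeasurableSpace α] {F : α → ℝ → ℝ≥0∞}
    (hF : Measurable (Function.uncurry F)) {b : α → ℝ} (hb : Measurable b) :
    Measurable fun a => ∫⁻ s in Ioc 0 (b a), F a s := by
  have hS : MeasurableSet {q : α × ℝ | 0 < q.2 ∧ q.2 ≤ b q.1} :=
    (measurableSet_lt measurable_const measurable_snd).inter
      (measurableSet_le measurable_snd (hb.comp measurable_fst))
  have h : ∀ a, ∫⁻ s in Ioc 0 (b a), F a s =
      ∫⁻ s, {q : α × ℝ | 0 < q.2 ∧ q.2 ≤ b q.1}.indicator (Function.uncurry F) (a, s) := by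
    intro a
    rw [← lintegral_indicator measurableSet_Ioc]
    rfl
  simp_rw [h]
  exact (hF.indicator hS).lintegral_prod_right'

/-- The damping factor `(v, s) ↦ e^{-σν(v)s}` is measurable as an `ℝ≥0∞`-valued function.
[folklore] -/
theorem measurable_dampingENN (σ : ℝ) {α : Type*} [MeasurableSpace α] {v : α → (EuclideanSpace ℝ d)} {s : α → ℝ}
    (hv : Measurable v) (hs : Measurable s) :
    Measurable fun a => ENNReal.ofReal (exp (-(σ * lorentzLossRate (v a) * s a))) :=
  ENNReal.measurable_ofReal.comp
    ((measurable_const.mul (continuous_lorentzLossRate.measurable.comp hv)).mul hs).neg.exp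

/-- **Joint measurability of the `ℝ≥0∞` backward terms** in `(b, t, x, v)` for a measurable
family of observables `Ψ b`. [folklore] -/
theorem measurable_lorentzDualTermENN_param {σ : ℝ} {β : Type*} [MeasurableSpace β]
    {Ψ : β → (EuclideanSpace ℝ d) → (EuclideanSpace ℝ d) → ℝ≥0∞} (hΨ : Measurable fun q : β × (EuclideanSpace ℝ d) × (EuclideanSpace ℝ d) => Ψ q.1 q.2.1 q.2.2) (n : ℕ) :
    Measurable fun p : β × ℝ × (EuclideanSpace ℝ d) × (EuclideanSpace ℝ d) =>
      lorentzDualTermENN (Literature.Analysis.FluidPDE.Euclidean.geometry d) σ (Ψ p.1) n p.2.1 p.2.2.1 p.2.2.2 := by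
  induction n generalizing β with
  | zero =>
    simp only [lorentzDualTermENN_zero, Literature.Analysis.FluidPDE.Euclidean.geometry_translate]
    refine Measurable.mul (measurable_dampingENN σ measurable_snd.snd.snd measurable_snd.fst) ?_
    exact hΨ.comp (measurable_fst.prodMk ((measurable_snd.snd.fst.add
      (measurable_snd.fst.smul measurable_snd.snd.snd)).prodMk measurable_snd.snd.snd))
  | succ n ih =>
    simp only [lorentzDualTermENN_succ, Literature.Analysis.FluidPDE.Euclidean.geometry_translate]
    refine measurable_setLIntegral_Ioc_param ?_ measurable_snd.fst
    refine Measurable.mul (measurable_dampingENN σ measurable_fst.snd.snd.snd measurable_snd)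
      (measurable_const.mul ?_)
    refine measurable_lorentzGainOpENN_param (α := (β × ℝ × (EuclideanSpace ℝ d) × (EuclideanSpace ℝ d)) × ℝ) ?_
      measurable_fst.snd.snd.snd
    -- `(q, w) ↦ wₙ[Ψ q.1.1](q.1.2.1 - q.2, q.1.2.2.1 + q.2 • q.1.2.2.2, w)`
    have := ih (β := β) hΨ
    exact this.comp (measurable_fst.fst.fst.prodMk ((measurable_fst.fst.snd.fst.sub
      measurable_fst.snd).prodMk ((measurable_fst.fst.snd.snd.fst.add
        (measurable_fst.snd.smul measurable_fst.fst.snd.snd.snd)).prodMk measurable_snd)))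

/-- **Joint measurability of the `ℝ≥0∞` backward terms** in `(t, x, v)`. [folklore] -/
theorem measurable_lorentzDualTermENN {σ : ℝ} {ψ : (EuclideanSpace ℝ d) → (EuclideanSpace ℝ d) → ℝ≥0∞}
    (hψ : Measurable (Function.uncurry ψ)) (n : ℕ) :
    Measurable fun p : ℝ × (EuclideanSpace ℝ d) × (EuclideanSpace ℝ d) =>
      lorentzDualTermENN (Literature.Analysis.FluidPDE.Euclidean.geometry d) σ ψ n p.1 p.2.1 p.2.2 :=
  (measurable_lorentzDualTermENN_param (β := Unit) (Ψ := fun _ => ψ) (σ := σ)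
    (hψ.comp measurable_snd) n).comp
    ((measurable_const : Measurable fun _ : ℝ × (EuclideanSpace ℝ d) × (EuclideanSpace ℝ d) => ()).prodMk measurable_id)

/-- **Joint measurability of the `ℝ≥0∞` forward terms** in `(b, t, x, v)` for a measurable
family of data `F b`. [folklore] -/
theorem measurable_lorentzSeriesTermENN_param {σ : ℝ} {β : Type*} [MeasurableSpace β]
    {F : β → (EuclideanSpace ℝ d) → (EuclideanSpace ℝ d) → ℝ≥0∞} (hF : Measurable fun q : β × (EuclideanSpace ℝ d) × (EuclideanSpace ℝ d) => F q.1 q.2.1 q.2.2) (n : ℕ) :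
    Measurable fun p : β × ℝ × (EuclideanSpace ℝ d) × (EuclideanSpace ℝ d) =>
      lorentzSeriesTermENN (Literature.Analysis.FluidPDE.Euclidean.geometry d) σ (F p.1) n p.2.1 p.2.2.1 p.2.2.2 := by
  induction n generalizing β with
  | zero =>
    simp only [lorentzSeriesTermENN_zero, Literature.Analysis.FluidPDE.Euclidean.geometry_translate]
    refine Measurable.mul (measurable_dampingENN σ measurable_snd.snd.snd measurable_snd.fst) ?_
    exact hF.comp (measurable_fst.prodMk ((measurable_snd.snd.fst.add
      (measurable_snd.fst.neg.smul measurable_snd.snd.snd)).prodMk measurable_snd.snd.snd))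
  | succ n ih =>
    simp only [lorentzSeriesTermENN_succ, Literature.Analysis.FluidPDE.Euclidean.geometry_translate]
    refine measurable_setLIntegral_Ioc_param ?_ measurable_snd.fst
    refine Measurable.mul (measurable_dampingENN σ measurable_fst.snd.snd.snd
      (measurable_fst.snd.fst.sub measurable_snd)) (measurable_const.mul ?_)
    refine measurable_lorentzGainOpENN_param (α := (β × ℝ × (EuclideanSpace ℝ d) × (EuclideanSpace ℝ d)) × ℝ) ?_
      measurable_fst.snd.snd.snd
    have := ih (β := β) hF
    exact this.comp (measurable_fst.fst.fst.prodMk (measurable_fst.snd.prodMk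
      ((measurable_fst.fst.snd.snd.fst.add ((measurable_fst.snd.sub
        measurable_fst.fst.snd.fst).smul measurable_fst.fst.snd.snd.snd)).prodMk measurable_snd)))

/-- **Joint measurability of the `ℝ≥0∞` forward terms** in `(t, x, v)`. [folklore] -/
theorem measurable_lorentzSeriesTermENN {σ : ℝ} {f₀ : (EuclideanSpace ℝ d) → (EuclideanSpace ℝ d) → ℝ≥0∞}
    (hf₀ : Measurable (Function.uncurry f₀)) (n : ℕ) :
    Measurable fun p : ℝ × (EuclideanSpace ℝ d) × (EuclideanSpace ℝ d) =>
      lorentzSeriesTermENN (Literature.Analysis.FluidPDE.Euclidean.geometry d) σ f₀ n p.1 p.2.1 p.2.2 :=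
  (measurable_lorentzSeriesTermENN_param (β := Unit) (F := fun _ => f₀) (σ := σ)
    (hf₀.comp measurable_snd) n).comp
    ((measurable_const : Measurable fun _ : ℝ × (EuclideanSpace ℝ d) × (EuclideanSpace ℝ d) => ()).prodMk measurable_id)

end ENNMeasurability

/-! ## Adjointness of free transport and of the gain operator on phase space -/

section Adjoint

variable {d : Type*} [Fintype d]


/-- **Adjointness of damped free transport** (Liouville): for measurable
`Ψ, Γ : ℝ^d × ℝ^d → [0, ∞]` and a measurable velocity weight `e`,
`∫⁻ Ψ(x, v) e(v) Γ(x - τv, v) = ∫⁻ e(v) Ψ(x + τv, v) Γ(x, v)` (translation invariance of Lebesgue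
measure in `x` for each `v`, Tonelli). [folklore] -/
theorem lintegral_transport_adjoint (τ : ℝ) {Ψ Γ : (EuclideanSpace ℝ d) × (EuclideanSpace ℝ d) → ℝ≥0∞} (hΨ : Measurable Ψ)
    (hΓ : Measurable Γ) {e : (EuclideanSpace ℝ d) → ℝ≥0∞} (he : Measurable e) :
    ∫⁻ z, Ψ z * (e z.2 * Γ (z.1 - τ • z.2, z.2)) = ∫⁻ z, (e z.2 * Ψ (z.1 + τ • z.2, z.2)) * Γ z := by
  have hL : Measurable fun z : (EuclideanSpace ℝ d) × (EuclideanSpace ℝ d) => Ψ z * (e z.2 * Γ (z.1 - τ • z.2, z.2)) :=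
    hΨ.mul ((he.comp measurable_snd).mul (hΓ.comp ((measurable_fst.sub
      (measurable_snd.const_smul τ)).prodMk measurable_snd)))
  have hR : Measurable fun z : (EuclideanSpace ℝ d) × (EuclideanSpace ℝ d) => (e z.2 * Ψ (z.1 + τ • z.2, z.2)) * Γ z :=
    ((he.comp measurable_snd).mul (hΨ.comp ((measurable_fst.add
      (measurable_snd.const_smul τ)).prodMk measurable_snd))).mul hΓ
  rw [MeasureTheory.Measure.volume_eq_prod, lintegral_prod_symm _ hL.aemeasurable,
    lintegral_prod_symm _ hR.aemeasurable]
  refine lintegral_congr fun v => ?_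
  rw [← lintegral_add_right_eq_self
    (fun x : (EuclideanSpace ℝ d) => Ψ (x, v) * (e v * Γ (x - τ • v, v))) (τ • v)]
  refine lintegral_congr fun x => ?_
  simp only [add_sub_cancel_right]
  ring

/-- **Adjointness of the gain operator on phase space**: for measurable
`Ψ, Γ : ℝ^d × ℝ^d → [0, ∞]`, `∫⁻ Ψ(x, v) (L⁺ Γ(x, ·))(v) = ∫⁻ (L⁺ Ψ(x, ·))(v) Γ(x, v)`
(`lintegral_mul_lorentzGainOpENN` fibrewise in `x`). [folklore] -/
theorem lintegral_gain_adjoint {Ψ Γ : (EuclideanSpace ℝ d) × (EuclideanSpace ℝ d) → ℝ≥0∞} (hΨ : Measurable Ψ) (hΓ : Measurable Γ) :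
    ∫⁻ z, Ψ z * lorentzGainOpENN (fun w => Γ (z.1, w)) z.2 =
      ∫⁻ z, lorentzGainOpENN (fun w => Ψ (z.1, w)) z.2 * Γ z := by
  have hGΓ : Measurable fun z : (EuclideanSpace ℝ d) × (EuclideanSpace ℝ d) => lorentzGainOpENN (fun w => Γ (z.1, w)) z.2 :=
    measurable_lorentzGainOpENN_param (α := (EuclideanSpace ℝ d) × (EuclideanSpace ℝ d)) (h := fun z w => Γ (z.1, w))
      (hΓ.comp (measurable_fst.fst.prodMk measurable_snd)) measurable_snd
  have hGΨ : Measurable fun z : (EuclideanSpace ℝ d) × (EuclideanSpace ℝ d) => lorentzGainOpENN (fun w => Ψ (z.1, w)) z.2 :=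
    measurable_lorentzGainOpENN_param (α := (EuclideanSpace ℝ d) × (EuclideanSpace ℝ d)) (h := fun z w => Ψ (z.1, w))
      (hΨ.comp (measurable_fst.fst.prodMk measurable_snd)) measurable_snd
  have hm1 : Measurable fun z : (EuclideanSpace ℝ d) × (EuclideanSpace ℝ d) => Ψ z * lorentzGainOpENN (fun w => Γ (z.1, w)) z.2 :=
    hΨ.mul hGΓ
  have hm2 : Measurable fun z : (EuclideanSpace ℝ d) × (EuclideanSpace ℝ d) => lorentzGainOpENN (fun w => Ψ (z.1, w)) z.2 * Γ z :=
    hGΨ.mul hΓ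
  rw [MeasureTheory.Measure.volume_eq_prod, lintegral_prod _ hm1.aemeasurable,
    lintegral_prod _ hm2.aemeasurable]
  refine lintegral_congr fun x => ?_
  exact lintegral_mul_lorentzGainOpENN (hΨ.comp (measurable_const.prodMk measurable_id))
    (hΓ.comp (measurable_const.prodMk measurable_id))

/-- **Tonelli on the time triangle**: for measurable `Φ : ℝ × ℝ → [0, ∞]`,
`∫⁻_{s ∈ (0,t]} ∫⁻_{r ∈ (0,t-s]} Φ(s, r) = ∫⁻_{s' ∈ (0,t]} ∫⁻_{q ∈ (0,s']} Φ(q, s' - q)`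
(the shear `(q, s') ↦ (q, s' - q)` maps `{0 < q ≤ s' ≤ t}` onto `{0 < q, 0 ≤ r ≤ t - q}`).
This is the reparametrisation "first collision at `s`, then `n` collisions in the remaining
time" ↔ "`n` collisions up to the last one at `s'`" of the collision series. [folklore] -/
theorem lintegral_triangle_shear {Φ : ℝ × ℝ → ℝ≥0∞} (hΦ : Measurable Φ) (t : ℝ) :
    ∫⁻ s in Ioc 0 t, ∫⁻ r in Ioc 0 (t - s), Φ (s, r) =
      ∫⁻ s' in Ioc 0 t, ∫⁻ q in Ioc 0 s', Φ (q, s' - q) := by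
  -- both sides as double integrals of indicator functions over ℝ × ℝ
  have hA : MeasurableSet {p : ℝ × ℝ | 0 < p.1 ∧ p.1 ≤ t ∧ 0 < p.2 ∧ p.2 ≤ t - p.1} :=
    (measurableSet_lt measurable_const measurable_fst).inter
      ((measurableSet_le measurable_fst measurable_const).inter
        ((measurableSet_lt measurable_const measurable_snd).inter
          (measurableSet_le measurable_snd (measurable_const.sub measurable_fst))))
  have hB : MeasurableSet {p : ℝ × ℝ | 0 < p.2 ∧ p.2 ≤ t ∧ 0 < p.1 ∧ p.1 ≤ p.2} :=
    (measurableSet_lt measurable_const measurable_snd).inter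
      ((measurableSet_le measurable_snd measurable_const).inter
        ((measurableSet_lt measurable_const measurable_fst).inter
          (measurableSet_le measurable_fst measurable_snd)))
  -- LHS = ∫⁻ s, ∫⁻ r, 1_A Φ
  have hL : ∫⁻ s in Ioc 0 t, ∫⁻ r in Ioc 0 (t - s), Φ (s, r) =
      ∫⁻ s, ∫⁻ r, {p : ℝ × ℝ | 0 < p.1 ∧ p.1 ≤ t ∧ 0 < p.2 ∧ p.2 ≤ t - p.1}.indicator Φ (s, r) := by
    rw [← lintegral_indicator measurableSet_Ioc]
    refine lintegral_congr fun s => ?_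
    by_cases hs : s ∈ Ioc 0 t
    · rw [indicator_of_mem hs, ← lintegral_indicator measurableSet_Ioc]
      refine lintegral_congr fun r => ?_
      simp only [indicator, mem_Ioc, mem_setOf_eq]
      rcases hs with ⟨hs0, hst⟩
      by_cases hr : 0 < r ∧ r ≤ t - s <;> simp [hr, hs0, hst]
    · rw [indicator_of_notMem hs]
      symm
      refine (lintegral_eq_zero_iff' ((hΦ.indicator hA).comp
        (measurable_const.prodMk measurable_id)).aemeasurable).2 (Eventually.of_forall fun r => ?_)
      simp only [Function.comp_apply, id_eq]
      rw [indicator_of_notMem]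
      · rfl
      · rw [mem_Ioc] at hs
        intro h
        rw [mem_setOf_eq] at h
        exact hs ⟨h.1, h.2.1⟩
  -- RHS = ∫⁻ s', ∫⁻ q, 1_B Φ(q, s' - q)
  have hR : ∫⁻ s' in Ioc 0 t, ∫⁻ q in Ioc 0 s', Φ (q, s' - q) =
      ∫⁻ s', ∫⁻ q, {p : ℝ × ℝ | 0 < p.2 ∧ p.2 ≤ t ∧ 0 < p.1 ∧ p.1 ≤ p.2}.indicator
        (fun p => Φ (p.1, p.2 - p.1)) (q, s') := by
    rw [← lintegral_indicator measurableSet_Ioc]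
    refine lintegral_congr fun s' => ?_
    by_cases hs : s' ∈ Ioc 0 t
    · rw [indicator_of_mem hs, ← lintegral_indicator measurableSet_Ioc]
      refine lintegral_congr fun q => ?_
      simp only [indicator, mem_Ioc, mem_setOf_eq]
      rcases hs with ⟨hs0, hst⟩
      by_cases hq : 0 < q ∧ q ≤ s' <;> simp [hq, hs0, hst]
    · rw [indicator_of_notMem hs]
      symm
      refine (lintegral_eq_zero_iff' (((hΦ.comp (measurable_fst.prodMk
        (measurable_snd.sub measurable_fst))).indicator hB).comp
        (measurable_id.prodMk measurable_const)).aemeasurable).2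
        (Eventually.of_forall fun q => ?_)
      simp only [Function.comp_apply, id_eq]
      rw [indicator_of_notMem]
      · rfl
      · rw [mem_Ioc] at hs
        intro h
        rw [mem_setOf_eq] at h
        exact hs ⟨h.1, h.2.1⟩
  rw [hL, hR]
  -- swap the right-hand side to `∫⁻ q, ∫⁻ s'`, then translate `s' = q + r`
  rw [lintegral_lintegral_swap (f := fun s' q => {p : ℝ × ℝ | 0 < p.2 ∧ p.2 ≤ t ∧ 0 < p.1 ∧
      p.1 ≤ p.2}.indicator (fun p => Φ (p.1, p.2 - p.1)) (q, s'))
    ((((hΦ.comp (measurable_fst.prodMk (measurable_snd.sub measurable_fst))).indicator hB).comp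
      measurable_swap).aemeasurable)]
  refine lintegral_congr fun q => ?_
  rw [← lintegral_add_right_eq_self (fun s' => {p : ℝ × ℝ | 0 < p.2 ∧ p.2 ≤ t ∧ 0 < p.1 ∧
      p.1 ≤ p.2}.indicator (fun p => Φ (p.1, p.2 - p.1)) (q, s')) q]
  -- now both sides are `∫⁻ r, …`; they agree off the null set `{r = 0}`
  refine lintegral_congr_ae ?_
  have : ∀ᵐ r : ℝ, r ≠ 0 := by
    simp [ae_iff]
  filter_upwards [this] with r hr
  simp only [indicator, mem_setOf_eq, add_sub_cancel_right]
  by_cases h1 : 0 < q ∧ q ≤ t ∧ 0 < r ∧ r ≤ t - q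
  · have h2 : 0 < r + q ∧ r + q ≤ t ∧ 0 < q ∧ q ≤ r + q :=
      ⟨by linarith [h1.1, h1.2.2.1], by linarith [h1.2.2.2], h1.1, by linarith [h1.2.2.1]⟩
    rw [if_pos h1, if_pos h2]
  · have h2 : ¬ (0 < r + q ∧ r + q ≤ t ∧ 0 < q ∧ q ≤ r + q) := by
      rintro ⟨h21, h22, h23, h24⟩
      refine h1 ⟨h23, by linarith, ?_, by linarith⟩
      rcases lt_or_gt_of_ne hr with hr' | hr'
      · linarith
      · exact hr'
    rw [if_neg h1, if_neg h2]

end Adjoint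

/-! ## First-collision versus last-collision form of the backward series -/

section Reparam

variable {d : Type*} [Fintype d]


/-- Measurability of the one-step observable family
`(τ, y, w) ↦ σ (L⁺[w' ↦ e^{-σν(w')τ} ψ(y + τw', w')])(w)` (collision, then damped free flight for
time `τ`, then evaluation of `ψ`). [folklore] -/
theorem measurable_collisionStepENN (σ : ℝ) {ψ : (EuclideanSpace ℝ d) → (EuclideanSpace ℝ d) → ℝ≥0∞}
    (hψ : Measurable (Function.uncurry ψ)) :
    Measurable fun q : ℝ × (EuclideanSpace ℝ d) × (EuclideanSpace ℝ d) => ENNReal.ofReal σ * lorentzGainOpENN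
      (fun w' => ENNReal.ofReal (exp (-(σ * lorentzLossRate w' * q.1))) *
        ψ (q.2.1 + q.1 • w') w') q.2.2 := by
  refine measurable_const.mul (measurable_lorentzGainOpENN_param (α := ℝ × (EuclideanSpace ℝ d) × (EuclideanSpace ℝ d)) ?_
    measurable_snd.snd)
  exact (measurable_dampingENN σ measurable_snd measurable_fst.fst).mul
    (hψ.comp ((measurable_fst.snd.fst.add (measurable_fst.fst.smul measurable_snd)).prodMk
      measurable_snd))

/-- **Last-collision form of the backward terms.** The backward term `w_{n+1}(t)`, defined by
peeling off the *first* collision (`lorentzDualTermENN_succ`), is also obtained by peeling off the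
*last* one: `w_{n+1}(t, x, v) = ∫⁻_{s ∈ (0,t]} wₙ[ψ_{t-s}](s, x, v)`, where
`ψ_τ(y, w) = σ (L⁺[w' ↦ e^{-σν(w')τ} ψ(y + τ w', w')])(w)` is the observable "collide, then fly
freely for time `τ`, then evaluate `ψ`" (Markov/semigroup property of the Dyson terms; Tonelli
on the time triangle, `lintegral_triangle_shear`). [folklore] -/
theorem lorentzDualTermENN_succ_eq_last (σ : ℝ) {ψ : (EuclideanSpace ℝ d) → (EuclideanSpace ℝ d) → ℝ≥0∞}
    (hψ : Measurable (Function.uncurry ψ)) (n : ℕ) (t : ℝ) (x v : (EuclideanSpace ℝ d)) :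
    lorentzDualTermENN (Literature.Analysis.FluidPDE.Euclidean.geometry d) σ ψ (n + 1) t x v =
      ∫⁻ s in Ioc 0 t, lorentzDualTermENN (Literature.Analysis.FluidPDE.Euclidean.geometry d) σ
        (fun y w => ENNReal.ofReal σ * lorentzGainOpENN
          (fun w' => ENNReal.ofReal (exp (-(σ * lorentzLossRate w' * (t - s)))) *
            ψ (y + (t - s) • w') w') w) n s x v := by
  induction n generalizing t x v with
  | zero =>
    simp only [lorentzDualTermENN_succ, Literature.Analysis.FluidPDE.Euclidean.geometry_translate]
    rfl
  | succ n ih =>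
    -- measurability of the integrand `Φ` of the triangle identity
    have hΨ := measurable_collisionStepENN σ hψ
    have hW := measurable_lorentzDualTermENN_param (σ := σ) (β := ℝ)
      (Ψ := fun τ y w => ENNReal.ofReal σ * lorentzGainOpENN
        (fun w' => ENNReal.ofReal (exp (-(σ * lorentzLossRate w' * τ))) * ψ (y + τ • w') w') w)
      hΨ n
    have hmap : Measurable fun q : (ℝ × ℝ) × sphere (0 : (EuclideanSpace ℝ d)) 1 =>
        (t - q.1.1 - q.1.2, q.1.2, x + q.1.1 • v,
          v - (2 * ⟪v, ((q.2 : sphere (0 : (EuclideanSpace ℝ d)) 1) : (EuclideanSpace ℝ d))⟫_ℝ) • ((q.2 : sphere (0 : (EuclideanSpace ℝ d)) 1) : (EuclideanSpace ℝ d))) :=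
      ((measurable_const.sub measurable_fst.fst).sub measurable_fst.snd).prodMk
        (measurable_fst.snd.prodMk ((measurable_const.add (measurable_fst.fst.smul
          measurable_const)).prodMk (measurable_reflectVelocity.comp
            (measurable_const.prodMk measurable_snd))))
    have hcomp : Measurable fun q : (ℝ × ℝ) × sphere (0 : (EuclideanSpace ℝ d)) 1 =>
        lorentzDualTermENN (Literature.Analysis.FluidPDE.Euclidean.geometry d) σ
          (fun y w => ENNReal.ofReal σ * lorentzGainOpENN
            (fun w' => ENNReal.ofReal (exp (-(σ * lorentzLossRate w' * (t - q.1.1 - q.1.2)))) *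
              ψ (y + (t - q.1.1 - q.1.2) • w') w') w)
          n q.1.2 (x + q.1.1 • v) (v - (2 * ⟪v, ((q.2 : sphere (0 : (EuclideanSpace ℝ d)) 1) : (EuclideanSpace ℝ d))⟫_ℝ) •
            ((q.2 : sphere (0 : (EuclideanSpace ℝ d)) 1) : (EuclideanSpace ℝ d))) := by
      have h := hW.comp hmap
      exact h
    have hk : Measurable fun q : (ℝ × ℝ) × sphere (0 : (EuclideanSpace ℝ d)) 1 =>
        ENNReal.ofReal (max ⟪v, ((q.2 : sphere (0 : (EuclideanSpace ℝ d)) 1) : (EuclideanSpace ℝ d))⟫_ℝ 0) :=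
      measurable_kernelENN.comp (measurable_const.prodMk measurable_snd)
    have hInner : Measurable fun q : (ℝ × ℝ) × sphere (0 : (EuclideanSpace ℝ d)) 1 =>
        ENNReal.ofReal (max ⟪v, ((q.2 : sphere (0 : (EuclideanSpace ℝ d)) 1) : (EuclideanSpace ℝ d))⟫_ℝ 0) *
          lorentzDualTermENN (Literature.Analysis.FluidPDE.Euclidean.geometry d) σ
            (fun y w => ENNReal.ofReal σ * lorentzGainOpENN
              (fun w' => ENNReal.ofReal (exp (-(σ * lorentzLossRate w' * (t - q.1.1 - q.1.2)))) *
                ψ (y + (t - q.1.1 - q.1.2) • w') w') w)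
            n q.1.2 (x + q.1.1 • v) (v - (2 * ⟪v, ((q.2 : sphere (0 : (EuclideanSpace ℝ d)) 1) : (EuclideanSpace ℝ d))⟫_ℝ) •
              ((q.2 : sphere (0 : (EuclideanSpace ℝ d)) 1) : (EuclideanSpace ℝ d))) := hk.mul hcomp
    have hΦm : Measurable fun p : ℝ × ℝ =>
        ENNReal.ofReal (exp (-(σ * lorentzLossRate v * p.1))) * (ENNReal.ofReal σ *
        ∫⁻ ω : sphere (0 : (EuclideanSpace ℝ d)) 1, ENNReal.ofReal (max ⟪v, (ω : (EuclideanSpace ℝ d))⟫_ℝ 0) *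
          lorentzDualTermENN (Literature.Analysis.FluidPDE.Euclidean.geometry d) σ
            (fun y w => ENNReal.ofReal σ * lorentzGainOpENN
              (fun w' => ENNReal.ofReal (exp (-(σ * lorentzLossRate w' * (t - p.1 - p.2)))) *
                ψ (y + (t - p.1 - p.2) • w') w') w)
            n p.2 (x + p.1 • v) (v - (2 * ⟪v, (ω : (EuclideanSpace ℝ d))⟫_ℝ) • (ω : (EuclideanSpace ℝ d))) ∂KineticTheory.sphereMeasure) :=
      (measurable_dampingENN σ measurable_const measurable_fst).mul
        (measurable_const.mul hInner.lintegral_prod_right')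
    set Φ : ℝ × ℝ → ℝ≥0∞ := fun p =>
      ENNReal.ofReal (exp (-(σ * lorentzLossRate v * p.1))) * (ENNReal.ofReal σ *
        ∫⁻ ω : sphere (0 : (EuclideanSpace ℝ d)) 1, ENNReal.ofReal (max ⟪v, (ω : (EuclideanSpace ℝ d))⟫_ℝ 0) *
          lorentzDualTermENN (Literature.Analysis.FluidPDE.Euclidean.geometry d) σ
            (fun y w => ENNReal.ofReal σ * lorentzGainOpENN
              (fun w' => ENNReal.ofReal (exp (-(σ * lorentzLossRate w' * (t - p.1 - p.2)))) *
                ψ (y + (t - p.1 - p.2) • w') w') w)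
            n p.2 (x + p.1 • v) (v - (2 * ⟪v, (ω : (EuclideanSpace ℝ d))⟫_ℝ) • (ω : (EuclideanSpace ℝ d))) ∂KineticTheory.sphereMeasure)
      with hΦ
    -- LHS = ∫⁻ s, ∫⁻ r ∈ (0, t-s], Φ (s, r)
    have hL : lorentzDualTermENN (Literature.Analysis.FluidPDE.Euclidean.geometry d) σ ψ (n + 1 + 1) t x v =
        ∫⁻ s in Ioc 0 t, ∫⁻ r in Ioc 0 (t - s), Φ (s, r) := by
      rw [lorentzDualTermENN_succ]
      simp only [Literature.Analysis.FluidPDE.Euclidean.geometry_translate]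
      refine setLIntegral_congr_fun measurableSet_Ioc (fun s hs => ?_)
      rw [lorentzGainOpENN_apply]
      simp_rw [ih]
      simp only [hΦ]
      -- pull the `r`-integral out of the `ω`-integral and the constants
      have hswap : ∫⁻ ω : sphere (0 : (EuclideanSpace ℝ d)) 1, ENNReal.ofReal (max ⟪v, (ω : (EuclideanSpace ℝ d))⟫_ℝ 0) *
          (∫⁻ r in Ioc 0 (t - s), lorentzDualTermENN (Literature.Analysis.FluidPDE.Euclidean.geometry d) σ
            (fun y w => ENNReal.ofReal σ * lorentzGainOpENN
              (fun w' => ENNReal.ofReal (exp (-(σ * lorentzLossRate w' * (t - s - r)))) *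
                ψ (y + (t - s - r) • w') w') w)
            n r (x + s • v) (v - (2 * ⟪v, (ω : (EuclideanSpace ℝ d))⟫_ℝ) • (ω : (EuclideanSpace ℝ d)))) ∂KineticTheory.sphereMeasure =
          ∫⁻ r in Ioc 0 (t - s), ∫⁻ ω : sphere (0 : (EuclideanSpace ℝ d)) 1, ENNReal.ofReal (max ⟪v, (ω : (EuclideanSpace ℝ d))⟫_ℝ 0) *
            lorentzDualTermENN (Literature.Analysis.FluidPDE.Euclidean.geometry d) σ
            (fun y w => ENNReal.ofReal σ * lorentzGainOpENN
              (fun w' => ENNReal.ofReal (exp (-(σ * lorentzLossRate w' * (t - s - r)))) *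
                ψ (y + (t - s - r) • w') w') w)
            n r (x + s • v) (v - (2 * ⟪v, (ω : (EuclideanSpace ℝ d))⟫_ℝ) • (ω : (EuclideanSpace ℝ d))) ∂KineticTheory.sphereMeasure := by
        have : ∀ ω : sphere (0 : (EuclideanSpace ℝ d)) 1, ENNReal.ofReal (max ⟪v, (ω : (EuclideanSpace ℝ d))⟫_ℝ 0) *
            (∫⁻ r in Ioc 0 (t - s), lorentzDualTermENN (Literature.Analysis.FluidPDE.Euclidean.geometry d) σ
              (fun y w => ENNReal.ofReal σ * lorentzGainOpENN
                (fun w' => ENNReal.ofReal (exp (-(σ * lorentzLossRate w' * (t - s - r)))) *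
                  ψ (y + (t - s - r) • w') w') w)
              n r (x + s • v) (v - (2 * ⟪v, (ω : (EuclideanSpace ℝ d))⟫_ℝ) • (ω : (EuclideanSpace ℝ d)))) =
            ∫⁻ r in Ioc 0 (t - s), ENNReal.ofReal (max ⟪v, (ω : (EuclideanSpace ℝ d))⟫_ℝ 0) *
              lorentzDualTermENN (Literature.Analysis.FluidPDE.Euclidean.geometry d) σ
              (fun y w => ENNReal.ofReal σ * lorentzGainOpENN
                (fun w' => ENNReal.ofReal (exp (-(σ * lorentzLossRate w' * (t - s - r)))) *
                  ψ (y + (t - s - r) • w') w') w)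
              n r (x + s • v) (v - (2 * ⟪v, (ω : (EuclideanSpace ℝ d))⟫_ℝ) • (ω : (EuclideanSpace ℝ d))) := fun ω =>
          (lintegral_const_mul' _ _ ENNReal.ofReal_ne_top).symm
        simp_rw [this]
        exact lintegral_lintegral_swap ((hInner.comp ((measurable_const.prodMk
          measurable_snd).prodMk measurable_fst)).aemeasurable)
      rw [hswap, ← lintegral_const_mul' _ _ ENNReal.ofReal_ne_top,
        ← lintegral_const_mul' _ _ ENNReal.ofReal_ne_top]
    -- RHS = ∫⁻ s', ∫⁻ q ∈ (0, s'], Φ (q, s' - q)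
    have hR : ∫⁻ s' in Ioc 0 t, lorentzDualTermENN (Literature.Analysis.FluidPDE.Euclidean.geometry d) σ
        (fun y w => ENNReal.ofReal σ * lorentzGainOpENN
          (fun w' => ENNReal.ofReal (exp (-(σ * lorentzLossRate w' * (t - s')))) *
            ψ (y + (t - s') • w') w') w) (n + 1) s' x v =
        ∫⁻ s' in Ioc 0 t, ∫⁻ q in Ioc 0 s', Φ (q, s' - q) := by
      refine setLIntegral_congr_fun measurableSet_Ioc (fun s' hs' => ?_)
      rw [lorentzDualTermENN_succ]
      simp only [Literature.Analysis.FluidPDE.Euclidean.geometry_translate, lorentzGainOpENN_apply, hΦ]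
      have e1 : ∀ q : ℝ, t - q - (s' - q) = t - s' := fun q => by ring
      simp_rw [e1]
    rw [hL, hR]
    exact lintegral_triangle_shear hΦm t

end Reparam

/-! ## Duality of the `ℝ≥0∞`-valued forward and backward series (Tonelli) -/

section DualityENN

variable {d : Type*} [Fintype d]


/-- **Termwise duality, `ℝ≥0∞` form.** For measurable `ψ, f₀ : ℝ^d × ℝ^d → [0, ∞]`, every `n`
and every `t`, `∫⁻ ψ · uₙ(t) = ∫⁻ wₙ(t) · f₀`: the backward term `wₙ(t)` (acting on the
observable) is the adjoint of the forward term `uₙ(t)` (acting on the datum). Induction on `n`: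
adjointness of damped free transport (`lintegral_transport_adjoint`) and of the gain operator
(`lintegral_gain_adjoint`), Tonelli in the collision time, and the last-collision form of the
backward terms (`lorentzDualTermENN_succ_eq_last`). [folklore] -/
theorem lintegral_mul_lorentzSeriesTermENN (σ : ℝ) {f₀ : (EuclideanSpace ℝ d) → (EuclideanSpace ℝ d) → ℝ≥0∞}
    (hf₀ : Measurable (Function.uncurry f₀)) (n : ℕ) {ψ : (EuclideanSpace ℝ d) → (EuclideanSpace ℝ d) → ℝ≥0∞}
    (hψ : Measurable (Function.uncurry ψ)) (t : ℝ) :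
    ∫⁻ z : (EuclideanSpace ℝ d) × (EuclideanSpace ℝ d), ψ z.1 z.2 * lorentzSeriesTermENN (Literature.Analysis.FluidPDE.Euclidean.geometry d) σ f₀ n t z.1 z.2 =
      ∫⁻ z : (EuclideanSpace ℝ d) × (EuclideanSpace ℝ d), lorentzDualTermENN (Literature.Analysis.FluidPDE.Euclidean.geometry d) σ ψ n t z.1 z.2 * f₀ z.1 z.2 := by
  induction n generalizing ψ t with
  | zero =>
    simp only [lorentzSeriesTermENN_zero, lorentzDualTermENN_zero, Literature.Analysis.FluidPDE.Euclidean.geometry_translate,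
      neg_smul, ← sub_eq_add_neg]
    exact lintegral_transport_adjoint t (Ψ := Function.uncurry ψ) (Γ := Function.uncurry f₀) hψ
      hf₀ (measurable_dampingENN σ measurable_id measurable_const)
  | succ n ih =>
    -- the collision-step observable family `ψ_τ`
    have hΨ := measurable_collisionStepENN σ hψ
    -- unfold the forward recursion and normalise `x + (s - t) • v = x - (t - s) • v`
    have hsub : ∀ (s : ℝ) (x v : (EuclideanSpace ℝ d)), x + (s - t) • v = x - (t - s) • v := fun s x v => by
      rw [sub_eq_add_neg x, ← neg_smul, neg_sub]
    simp only [lorentzSeriesTermENN_succ, Literature.Analysis.FluidPDE.Euclidean.geometry_translate, hsub]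
    -- measurability of the `(z, s)`-integrand on the left
    have hU := measurable_lorentzSeriesTermENN (σ := σ) hf₀ n
    have hGain : Measurable fun q : ((EuclideanSpace ℝ d) × (EuclideanSpace ℝ d)) × ℝ =>
        lorentzGainOpENN (fun w => lorentzSeriesTermENN (Literature.Analysis.FluidPDE.Euclidean.geometry d) σ f₀ n q.2
          (q.1.1 - (t - q.2) • q.1.2) w) q.1.2 := by
      refine measurable_lorentzGainOpENN_param (α := ((EuclideanSpace ℝ d) × (EuclideanSpace ℝ d)) × ℝ) ?_ measurable_fst.snd
      have hm : Measurable fun r : (((EuclideanSpace ℝ d) × (EuclideanSpace ℝ d)) × ℝ) × (EuclideanSpace ℝ d) =>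
          (r.1.2, r.1.1.1 - (t - r.1.2) • r.1.1.2, r.2) :=
        measurable_fst.snd.prodMk ((measurable_fst.fst.fst.sub ((measurable_const.sub
          measurable_fst.snd).smul measurable_fst.fst.snd)).prodMk measurable_snd)
      have h := hU.comp hm
      exact h
    have hL2 : Measurable fun q : ((EuclideanSpace ℝ d) × (EuclideanSpace ℝ d)) × ℝ =>
        (ENNReal.ofReal (exp (-(σ * lorentzLossRate q.1.2 * (t - q.2)))) * (ENNReal.ofReal σ *
          lorentzGainOpENN (fun w => lorentzSeriesTermENN (Literature.Analysis.FluidPDE.Euclidean.geometry d) σ f₀ n q.2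
            (q.1.1 - (t - q.2) • q.1.2) w) q.1.2)) :=
      (measurable_dampingENN σ measurable_fst.snd (measurable_const.sub measurable_snd)).mul
        (measurable_const.mul hGain)
    have hL : Measurable fun q : ((EuclideanSpace ℝ d) × (EuclideanSpace ℝ d)) × ℝ => ψ q.1.1 q.1.2 *
        (ENNReal.ofReal (exp (-(σ * lorentzLossRate q.1.2 * (t - q.2)))) * (ENNReal.ofReal σ *
          lorentzGainOpENN (fun w => lorentzSeriesTermENN (Literature.Analysis.FluidPDE.Euclidean.geometry d) σ f₀ n q.2
            (q.1.1 - (t - q.2) • q.1.2) w) q.1.2)) :=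
      (hψ.comp measurable_fst).mul hL2
    -- Step 1: constants in, swap `z` and `s`
    have h1 : ∫⁻ z : (EuclideanSpace ℝ d) × (EuclideanSpace ℝ d), ψ z.1 z.2 * ∫⁻ s in Ioc 0 t,
        ENNReal.ofReal (exp (-(σ * lorentzLossRate z.2 * (t - s)))) * (ENNReal.ofReal σ *
          lorentzGainOpENN (fun w => lorentzSeriesTermENN (Literature.Analysis.FluidPDE.Euclidean.geometry d) σ f₀ n s
            (z.1 - (t - s) • z.2) w) z.2) =
        ∫⁻ s in Ioc 0 t, ∫⁻ z : (EuclideanSpace ℝ d) × (EuclideanSpace ℝ d), ψ z.1 z.2 *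
          (ENNReal.ofReal (exp (-(σ * lorentzLossRate z.2 * (t - s)))) * (ENNReal.ofReal σ *
            lorentzGainOpENN (fun w => lorentzSeriesTermENN (Literature.Analysis.FluidPDE.Euclidean.geometry d) σ f₀ n s
              (z.1 - (t - s) • z.2) w) z.2)) := by
      have : ∀ z : (EuclideanSpace ℝ d) × (EuclideanSpace ℝ d), ψ z.1 z.2 * ∫⁻ s in Ioc 0 t,
          ENNReal.ofReal (exp (-(σ * lorentzLossRate z.2 * (t - s)))) * (ENNReal.ofReal σ *
            lorentzGainOpENN (fun w => lorentzSeriesTermENN (Literature.Analysis.FluidPDE.Euclidean.geometry d) σ f₀ n s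
              (z.1 - (t - s) • z.2) w) z.2) =
          ∫⁻ s in Ioc 0 t, ψ z.1 z.2 *
            (ENNReal.ofReal (exp (-(σ * lorentzLossRate z.2 * (t - s)))) * (ENNReal.ofReal σ *
              lorentzGainOpENN (fun w => lorentzSeriesTermENN (Literature.Analysis.FluidPDE.Euclidean.geometry d) σ f₀ n s
                (z.1 - (t - s) • z.2) w) z.2)) := fun z => by
        rw [lintegral_const_mul]
        have h := hL2.comp ((measurable_const (a := z)).prodMk measurable_id)
        exact h
      simp_rw [this]
      exact lintegral_lintegral_swap (f := fun (z : (EuclideanSpace ℝ d) × (EuclideanSpace ℝ d)) (s : ℝ) => ψ z.1 z.2 *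
          (ENNReal.ofReal (exp (-(σ * lorentzLossRate z.2 * (t - s)))) * (ENNReal.ofReal σ *
            lorentzGainOpENN (fun w => lorentzSeriesTermENN (Literature.Analysis.FluidPDE.Euclidean.geometry d) σ f₀ n s
              (z.1 - (t - s) • z.2) w) z.2))) hL.aemeasurable
    rw [h1]
    -- Step 2: for fixed `s`, transport adjointness, gain adjointness, induction hypothesis
    have h2 : ∀ s : ℝ, ∫⁻ z : (EuclideanSpace ℝ d) × (EuclideanSpace ℝ d), ψ z.1 z.2 *
        (ENNReal.ofReal (exp (-(σ * lorentzLossRate z.2 * (t - s)))) * (ENNReal.ofReal σ *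
          lorentzGainOpENN (fun w => lorentzSeriesTermENN (Literature.Analysis.FluidPDE.Euclidean.geometry d) σ f₀ n s
            (z.1 - (t - s) • z.2) w) z.2)) =
        ∫⁻ z : (EuclideanSpace ℝ d) × (EuclideanSpace ℝ d), lorentzDualTermENN (Literature.Analysis.FluidPDE.Euclidean.geometry d) σ
          (fun y w => ENNReal.ofReal σ * lorentzGainOpENN
            (fun w' => ENNReal.ofReal (exp (-(σ * lorentzLossRate w' * (t - s)))) *
              ψ (y + (t - s) • w') w') w) n s z.1 z.2 * f₀ z.1 z.2 := by
      intro s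
      -- transport adjointness with `Γ(y, v) = σ L⁺[uₙ(s, y, ·)](v)`
      have hΓ : Measurable fun z : (EuclideanSpace ℝ d) × (EuclideanSpace ℝ d) => ENNReal.ofReal σ *
          lorentzGainOpENN (fun w => lorentzSeriesTermENN (Literature.Analysis.FluidPDE.Euclidean.geometry d) σ f₀ n s z.1 w)
            z.2 := by
        refine measurable_const.mul (measurable_lorentzGainOpENN_param (α := (EuclideanSpace ℝ d) × (EuclideanSpace ℝ d)) ?_
          measurable_snd)
        have hm : Measurable fun r : ((EuclideanSpace ℝ d) × (EuclideanSpace ℝ d)) × (EuclideanSpace ℝ d) => (s, r.1.1, r.2) :=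
          measurable_const.prodMk (measurable_fst.fst.prodMk measurable_snd)
        have h := hU.comp hm
        exact h
      have hA := lintegral_transport_adjoint (t - s) (Ψ := fun z : (EuclideanSpace ℝ d) × (EuclideanSpace ℝ d) => ψ z.1 z.2) hψ hΓ
        (e := fun v => ENNReal.ofReal (exp (-(σ * lorentzLossRate v * (t - s)))))
        (measurable_dampingENN σ measurable_id measurable_const)
      rw [hA]
      -- gain adjointness with `Ψ'(y, v) = e^{-σν(v)(t-s)} ψ(y + (t-s)v, v)`
      have hΨ' : Measurable fun z : (EuclideanSpace ℝ d) × (EuclideanSpace ℝ d) =>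
          ENNReal.ofReal (exp (-(σ * lorentzLossRate z.2 * (t - s)))) *
            ψ (z.1 + (t - s) • z.2) z.2 :=
        (measurable_dampingENN σ measurable_snd measurable_const).mul
          (hψ.comp ((measurable_fst.add (measurable_snd.const_smul (t - s))).prodMk
            measurable_snd))
      have hΓ' : Measurable fun z : (EuclideanSpace ℝ d) × (EuclideanSpace ℝ d) =>
          lorentzSeriesTermENN (Literature.Analysis.FluidPDE.Euclidean.geometry d) σ f₀ n s z.1 z.2 := by
        have h := hU.comp ((measurable_const (a := s)).prodMk measurable_id)
        exact h
      have hB := lintegral_gain_adjoint hΨ'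
        (Γ := fun z : (EuclideanSpace ℝ d) × (EuclideanSpace ℝ d) => lorentzSeriesTermENN (Literature.Analysis.FluidPDE.Euclidean.geometry d) σ f₀ n s z.1 z.2) hΓ'
      have hB' : ∫⁻ z : (EuclideanSpace ℝ d) × (EuclideanSpace ℝ d), ENNReal.ofReal (exp (-(σ * lorentzLossRate z.2 * (t - s)))) *
          ψ (z.1 + (t - s) • z.2) z.2 * (ENNReal.ofReal σ *
            lorentzGainOpENN (fun w => lorentzSeriesTermENN (Literature.Analysis.FluidPDE.Euclidean.geometry d) σ f₀ n s z.1 w)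
              z.2) =
          ∫⁻ z : (EuclideanSpace ℝ d) × (EuclideanSpace ℝ d), (ENNReal.ofReal σ * lorentzGainOpENN (fun w =>
            ENNReal.ofReal (exp (-(σ * lorentzLossRate w * (t - s)))) * ψ (z.1 + (t - s) • w) w)
              z.2) * lorentzSeriesTermENN (Literature.Analysis.FluidPDE.Euclidean.geometry d) σ f₀ n s z.1 z.2 := by
        have e1 : ∀ z : (EuclideanSpace ℝ d) × (EuclideanSpace ℝ d), ENNReal.ofReal (exp (-(σ * lorentzLossRate z.2 * (t - s)))) *
            ψ (z.1 + (t - s) • z.2) z.2 * (ENNReal.ofReal σ *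
              lorentzGainOpENN (fun w => lorentzSeriesTermENN (Literature.Analysis.FluidPDE.Euclidean.geometry d) σ f₀ n s
                z.1 w) z.2) = ENNReal.ofReal σ * (ENNReal.ofReal (exp (-(σ * lorentzLossRate z.2 *
                  (t - s)))) * ψ (z.1 + (t - s) • z.2) z.2 *
              lorentzGainOpENN (fun w => lorentzSeriesTermENN (Literature.Analysis.FluidPDE.Euclidean.geometry d) σ f₀ n s
                z.1 w) z.2) := fun z => by ring
        have e2 : ∀ z : (EuclideanSpace ℝ d) × (EuclideanSpace ℝ d), (ENNReal.ofReal σ * lorentzGainOpENN (fun w =>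
            ENNReal.ofReal (exp (-(σ * lorentzLossRate w * (t - s)))) * ψ (z.1 + (t - s) • w) w)
              z.2) * lorentzSeriesTermENN (Literature.Analysis.FluidPDE.Euclidean.geometry d) σ f₀ n s z.1 z.2 =
            ENNReal.ofReal σ * (lorentzGainOpENN (fun w =>
              ENNReal.ofReal (exp (-(σ * lorentzLossRate w * (t - s)))) * ψ (z.1 + (t - s) • w) w)
                z.2 * lorentzSeriesTermENN (Literature.Analysis.FluidPDE.Euclidean.geometry d) σ f₀ n s z.1 z.2) :=
          fun z => by ring
        simp_rw [e1, e2]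
        rw [lintegral_const_mul' _ _ ENNReal.ofReal_ne_top,
          lintegral_const_mul' _ _ ENNReal.ofReal_ne_top, hB]
      rw [hB']
      -- induction hypothesis with the observable `ψ_{t-s}`
      have hψs : Measurable (Function.uncurry fun (y : (EuclideanSpace ℝ d)) (w : (EuclideanSpace ℝ d)) => ENNReal.ofReal σ *
          lorentzGainOpENN (fun w' => ENNReal.ofReal (exp (-(σ * lorentzLossRate w' * (t - s)))) *
            ψ (y + (t - s) • w') w') w) := by
        have h := hΨ.comp ((measurable_const (a := t - s)).prodMk measurable_id)
        exact h
      exact ih hψs s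
    simp_rw [h2]
    -- Step 3: swap back and recognise the last-collision form of `w_{n+1}(t)`
    have hW := measurable_lorentzDualTermENN_param (σ := σ) (β := ℝ)
      (Ψ := fun τ y w => ENNReal.ofReal σ * lorentzGainOpENN
        (fun w' => ENNReal.ofReal (exp (-(σ * lorentzLossRate w' * τ))) * ψ (y + τ • w') w') w)
      hΨ n
    have hmap : Measurable fun q : ℝ × (EuclideanSpace ℝ d) × (EuclideanSpace ℝ d) => (t - q.1, q.1, q.2.1, q.2.2) :=
      (measurable_const.sub measurable_fst).prodMk measurable_id
    have hWs : Measurable fun q : ℝ × (EuclideanSpace ℝ d) × (EuclideanSpace ℝ d) => lorentzDualTermENN (Literature.Analysis.FluidPDE.Euclidean.geometry d) σ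
        (fun y w => ENNReal.ofReal σ * lorentzGainOpENN
          (fun w' => ENNReal.ofReal (exp (-(σ * lorentzLossRate w' * (t - q.1)))) *
            ψ (y + (t - q.1) • w') w') w) n q.1 q.2.1 q.2.2 := by
      have h := hW.comp hmap
      exact h
    have hR : Measurable fun q : ℝ × (EuclideanSpace ℝ d) × (EuclideanSpace ℝ d) => lorentzDualTermENN (Literature.Analysis.FluidPDE.Euclidean.geometry d) σ
        (fun y w => ENNReal.ofReal σ * lorentzGainOpENN
          (fun w' => ENNReal.ofReal (exp (-(σ * lorentzLossRate w' * (t - q.1)))) *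
            ψ (y + (t - q.1) • w') w') w) n q.1 q.2.1 q.2.2 * f₀ q.2.1 q.2.2 :=
      hWs.mul (hf₀.comp measurable_snd)
    rw [lintegral_lintegral_swap (f := fun (s : ℝ) (z : (EuclideanSpace ℝ d) × (EuclideanSpace ℝ d)) =>
      lorentzDualTermENN (Literature.Analysis.FluidPDE.Euclidean.geometry d) σ
        (fun y w => ENNReal.ofReal σ * lorentzGainOpENN
          (fun w' => ENNReal.ofReal (exp (-(σ * lorentzLossRate w' * (t - s)))) *
            ψ (y + (t - s) • w') w') w) n s z.1 z.2 * f₀ z.1 z.2) hR.aemeasurable]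
    refine lintegral_congr fun z => ?_
    rw [lintegral_mul_const, lorentzDualTermENN_succ_eq_last σ hψ n t z.1 z.2]
    have h := hWs.comp (measurable_id.prodMk (measurable_const (a := z)))
    exact h

end DualityENN





end Kinetic

end

end Literature.MathematicalPhysics.KineticTheory

namespace Literature.MathematicalPhysics.KineticTheory

noncomputable section

section Kinetic

open MeasureTheory Metric Real Set Filter Topology
open scoped InnerProductSpace ENNReal

/-! ## The backward terms: continuity, the sharp factorial bound, linearity -/

section DualReal

variable {d : Type*} [Fintype d]


/-- **Joint continuity of the backward terms** in `(t, x, v)` (induction; parametric interval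
integral of a jointly continuous integrand). [folklore] -/
theorem continuous_lorentzDualTerm {σ : ℝ} {ψ : (EuclideanSpace ℝ d) → (EuclideanSpace ℝ d) → ℝ}
    (hψ : Continuous (Function.uncurry ψ)) (n : ℕ) :
    Continuous fun p : ℝ × (EuclideanSpace ℝ d) × (EuclideanSpace ℝ d) =>
      lorentzDualTerm (Literature.Analysis.FluidPDE.Euclidean.geometry d) σ ψ n p.1 p.2.1 p.2.2 := by
  induction n with
  | zero =>
    simp only [lorentzDualTerm_zero, Literature.Analysis.FluidPDE.Euclidean.geometry_translate]
    refine Continuous.mul ?_ ?_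
    · refine (Continuous.neg ?_).rexp
      exact (continuous_const.mul (continuous_lorentzLossRate.comp continuous_snd.snd)).mul
        continuous_fst
    · exact hψ.comp ((continuous_snd.fst.add (continuous_fst.smul continuous_snd.snd)).prodMk
        continuous_snd.snd)
  | succ n ih =>
    simp only [lorentzDualTerm_succ, Literature.Analysis.FluidPDE.Euclidean.geometry_translate]
    have hF : Continuous (Function.uncurry fun (p : ℝ × (EuclideanSpace ℝ d) × (EuclideanSpace ℝ d)) (s : ℝ) =>
        exp (-(σ * lorentzLossRate p.2.2 * s)) *
          (σ * lorentzGainOp (lorentzDualTerm (Literature.Analysis.FluidPDE.Euclidean.geometry d) σ ψ n (p.1 - s)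
            (p.2.1 + s • p.2.2)) p.2.2)) := by
      refine Continuous.mul ?_ (continuous_const.mul ?_)
      · refine (Continuous.neg ?_).rexp
        exact (continuous_const.mul
          (continuous_lorentzLossRate.comp continuous_fst.snd.snd)).mul continuous_snd
      · have hh : Continuous fun q : ((ℝ × (EuclideanSpace ℝ d) × (EuclideanSpace ℝ d)) × ℝ) × (EuclideanSpace ℝ d) =>
            lorentzDualTerm (Literature.Analysis.FluidPDE.Euclidean.geometry d) σ ψ n (q.1.1.1 - q.1.2)
              (q.1.1.2.1 + q.1.2 • q.1.1.2.2) q.2 := by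
          have harg : Continuous fun q : ((ℝ × (EuclideanSpace ℝ d) × (EuclideanSpace ℝ d)) × ℝ) × (EuclideanSpace ℝ d) =>
              (q.1.1.1 - q.1.2, q.1.1.2.1 + q.1.2 • q.1.1.2.2, q.2) :=
            (continuous_fst.fst.fst.sub continuous_fst.snd).prodMk
              ((continuous_fst.fst.snd.fst.add
                (continuous_fst.snd.smul continuous_fst.fst.snd.snd)).prodMk continuous_snd)
          exact ih.comp harg
        exact continuous_lorentzGainOp_param hh continuous_fst.snd.snd
    exact intervalIntegral.continuous_parametric_intervalIntegral_of_continuous hF continuous_fst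

/-- Continuity of the backward terms in the velocity slot, jointly with parameters. [folklore] -/
theorem continuous_lorentzDualTerm_comp {σ : ℝ} {ψ : (EuclideanSpace ℝ d) → (EuclideanSpace ℝ d) → ℝ}
    (hψ : Continuous (Function.uncurry ψ)) (n : ℕ)
    {Y : Type*} [TopologicalSpace Y] {s : Y → ℝ} {y : Y → (EuclideanSpace ℝ d)} {w : Y → (EuclideanSpace ℝ d)} (hs : Continuous s)
    (hy : Continuous y) (hw : Continuous w) :
    Continuous fun q : Y => lorentzDualTerm (Literature.Analysis.FluidPDE.Euclidean.geometry d) σ ψ n (s q) (y q) (w q) :=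
  (continuous_lorentzDualTerm hψ n).comp (hs.prodMk (hy.prodMk hw))

omit [Fintype d] in
/-- **Gain bound through the loss frequency**: if `|g| ≤ B` at all reflected velocities of `v`,
then `|(L⁺ g)(v)| ≤ ν(v) B` (no integrability hypothesis: the bound `(v·ω)₊ B` is integrable).
[folklore] -/
theorem abs_lorentzGainOp_le_lossRate_mul {E : Type*} [NormedAddCommGroup E]
    [InnerProductSpace ℝ E] [FiniteDimensional ℝ E] [MeasurableSpace E] [BorelSpace E]
    {g : E → ℝ} {v : E} {B : ℝ}
    (hB : ∀ ω : sphere (0 : E) 1, |g (v - (2 * ⟪v, (ω : E)⟫_ℝ) • (ω : E))| ≤ B) :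
    |lorentzGainOp g v| ≤ lorentzLossRate v * B := by
  have hint : Integrable (fun ω : sphere (0 : E) 1 => max ⟪v, (ω : E)⟫_ℝ 0 * B)
      KineticTheory.sphereMeasure :=
    (((continuous_const.inner continuous_subtype_val).max continuous_const).mul
      continuous_const).integrable_of_hasCompactSupport (HasCompactSupport.of_compactSpace _)
  have h := norm_integral_le_of_norm_le (f := fun ω : sphere (0 : E) 1 =>
      max ⟪v, (ω : E)⟫_ℝ 0 * g (v - (2 * ⟪v, (ω : E)⟫_ℝ) • (ω : E))) hint
    (Eventually.of_forall fun ω => by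
      rw [Real.norm_eq_abs, abs_mul, abs_of_nonneg (le_max_right _ _)]
      exact mul_le_mul_of_nonneg_left (hB ω) (le_max_right _ _))
  rw [Real.norm_eq_abs] at h
  unfold lorentzGainOp lorentzLossRate
  rwa [integral_mul_const] at h

/-- **Sharp factorial bound on the backward terms**: for `σ ≥ 0`, `|ψ| ≤ C` and `t ≥ 0`,
`|wₙ(t, x, v)| ≤ C e^{-σν(v)t} (σν(v)t)ⁿ / n!` — the probability that the random flight from
`(x, v)` has exactly `n` collisions in `[0, t]`, times `‖ψ‖_∞` (the loss frequency is constant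
along the flight since the speed is, `lorentzLossRate_reflect`). [folklore] -/
theorem abs_lorentzDualTerm_le {σ : ℝ} (hσ : 0 ≤ σ) {ψ : (EuclideanSpace ℝ d) → (EuclideanSpace ℝ d) → ℝ} {C : ℝ}
    (hC : ∀ x v, |ψ x v| ≤ C) (n : ℕ) {t : ℝ} (ht : 0 ≤ t) (x v : (EuclideanSpace ℝ d)) :
    |lorentzDualTerm (Literature.Analysis.FluidPDE.Euclidean.geometry d) σ ψ n t x v| ≤
      C * exp (-(σ * lorentzLossRate v * t)) * (σ * lorentzLossRate v * t) ^ n / (Nat.factorial n : ℝ) := by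
  induction n generalizing t x v with
  | zero =>
    rw [lorentzDualTerm_zero, abs_mul, abs_of_pos (exp_pos _), pow_zero, mul_one,
      Nat.factorial_zero, Nat.cast_one, div_one, mul_comm C]
    exact mul_le_mul_of_nonneg_left (hC _ _) (exp_pos _).le
  | succ n ih =>
    rw [lorentzDualTerm_succ]
    have hlam0 : 0 ≤ σ * lorentzLossRate v := mul_nonneg hσ (lorentzLossRate_nonneg v)
    have hC0 : 0 ≤ C := (abs_nonneg _).trans (hC x v)
    -- pointwise bound of the integrand on `(0, t]`
    have hbound : ∀ s ∈ Ioc (0 : ℝ) t,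
        ‖exp (-(σ * lorentzLossRate v * s)) *
          (σ * lorentzGainOp (lorentzDualTerm (Literature.Analysis.FluidPDE.Euclidean.geometry d) σ ψ n (t - s)
            ((Literature.Analysis.FluidPDE.Euclidean.geometry d).translate x (s • v))) v)‖ ≤
        C * exp (-(σ * lorentzLossRate v * t)) * (σ * lorentzLossRate v) ^ (n + 1) / (Nat.factorial n : ℝ) *
          (t - s) ^ n := by
      intro s hs
      have hts : 0 ≤ t - s := sub_nonneg.2 hs.2
      have hgain : |lorentzGainOp (lorentzDualTerm (Literature.Analysis.FluidPDE.Euclidean.geometry d) σ ψ n (t - s)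
          ((Literature.Analysis.FluidPDE.Euclidean.geometry d).translate x (s • v))) v| ≤
          lorentzLossRate v * (C * exp (-(σ * lorentzLossRate v * (t - s))) *
            (σ * lorentzLossRate v * (t - s)) ^ n / (Nat.factorial n : ℝ)) := by
        refine abs_lorentzGainOp_le_lossRate_mul fun ω => ?_
        have := ih hts ((Literature.Analysis.FluidPDE.Euclidean.geometry d).translate x (s • v))
          (v - (2 * ⟪v, (ω : (EuclideanSpace ℝ d))⟫_ℝ) • (ω : (EuclideanSpace ℝ d)))
        rwa [lorentzLossRate_reflect] at this
      have hexp : exp (-(σ * lorentzLossRate v * s)) * exp (-(σ * lorentzLossRate v * (t - s))) =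
          exp (-(σ * lorentzLossRate v * t)) := by
        rw [← exp_add]; congr 1; ring
      rw [Real.norm_eq_abs, abs_mul, abs_of_pos (exp_pos _), abs_mul, abs_of_nonneg hσ]
      calc exp (-(σ * lorentzLossRate v * s)) *
            (σ * |lorentzGainOp (lorentzDualTerm (Literature.Analysis.FluidPDE.Euclidean.geometry d) σ ψ n (t - s)
              ((Literature.Analysis.FluidPDE.Euclidean.geometry d).translate x (s • v))) v|)
          ≤ exp (-(σ * lorentzLossRate v * s)) * (σ * (lorentzLossRate v *
              (C * exp (-(σ * lorentzLossRate v * (t - s))) *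
                (σ * lorentzLossRate v * (t - s)) ^ n / (Nat.factorial n : ℝ)))) :=
            mul_le_mul_of_nonneg_left (mul_le_mul_of_nonneg_left hgain hσ) (exp_pos _).le
        _ = (exp (-(σ * lorentzLossRate v * s)) * exp (-(σ * lorentzLossRate v * (t - s)))) *
              (C * (σ * lorentzLossRate v) ^ (n + 1) / (Nat.factorial n : ℝ) * (t - s) ^ n) := by
            rw [mul_pow]; ring
        _ = C * exp (-(σ * lorentzLossRate v * t)) * (σ * lorentzLossRate v) ^ (n + 1) / (Nat.factorial n : ℝ) *
              (t - s) ^ n := by rw [hexp]; ring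
    -- integrate the bound
    have hint : IntervalIntegrable (fun s : ℝ => C * exp (-(σ * lorentzLossRate v * t)) *
        (σ * lorentzLossRate v) ^ (n + 1) / (Nat.factorial n : ℝ) * (t - s) ^ n) volume 0 t :=
      (continuous_const.mul ((continuous_const.sub continuous_id).pow n)).intervalIntegrable _ _
    have h1 := intervalIntegral.norm_integral_le_of_norm_le ht
      (Eventually.of_forall fun s hs => hbound s hs) hint
    rw [Real.norm_eq_abs] at h1
    refine h1.trans (le_of_eq ?_)
    rw [intervalIntegral.integral_const_mul]
    have hpow : ∫ s in (0 : ℝ)..t, (t - s) ^ n = t ^ (n + 1) / (n + 1) := by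
      rw [intervalIntegral.integral_comp_sub_left (fun u => u ^ n) t, sub_self, sub_zero,
        integral_pow]
      simp
    rw [hpow, Nat.factorial_succ, Nat.cast_mul, Nat.cast_succ]
    field_simp
    ring

/-- The bound `C e^{-λt} (λt)ⁿ/n!` sums to `C` (Poisson probabilities): the backward series of
a bounded observable converges absolutely and `∑ₙ |wₙ(t, x, v)| ≤ C`. [folklore] -/
theorem hasSum_dualBound (C lam : ℝ) (hlam : 0 ≤ lam) :
    HasSum (fun n : ℕ => C * exp (-lam) * lam ^ n / (Nat.factorial n : ℝ)) C := by
  set r : NNReal := ⟨lam, hlam⟩ with hr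
  have hr' : (r : ℝ) = lam := rfl
  have h := (ProbabilityTheory.hasSum_one_poissonMeasure r).mul_left C
  rw [hr', mul_one] at h
  have e : (fun n : ℕ => C * exp (-lam) * lam ^ n / (Nat.factorial n : ℝ)) =
      fun i : ℕ => C * (exp (-lam) * lam ^ i / (Nat.factorial i : ℝ)) := by
    funext n; ring
  rw [e]
  exact h

/-- Summability of `∑ₙ |wₙ(t, x, v)|` for a bounded observable, `σ ≥ 0`, `t ≥ 0`. [folklore] -/
theorem summable_abs_lorentzDualTerm {σ : ℝ} (hσ : 0 ≤ σ) {ψ : (EuclideanSpace ℝ d) → (EuclideanSpace ℝ d) → ℝ} {C : ℝ}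
    (hC : ∀ x v, |ψ x v| ≤ C) {t : ℝ} (ht : 0 ≤ t) (x v : (EuclideanSpace ℝ d)) :
    Summable fun n => |lorentzDualTerm (Literature.Analysis.FluidPDE.Euclidean.geometry d) σ ψ n t x v| := by
  refine Summable.of_nonneg_of_le (fun n => abs_nonneg _)
    (fun n => abs_lorentzDualTerm_le hσ hC n ht x v) ?_
  have := (hasSum_dualBound C (σ * lorentzLossRate v * t)
    (mul_nonneg (mul_nonneg hσ (lorentzLossRate_nonneg v)) ht)).summable
  exact this

/-- Summability of the backward series of a bounded observable, `σ ≥ 0`, `t ≥ 0`. [folklore] -/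
theorem summable_lorentzDualTerm {σ : ℝ} (hσ : 0 ≤ σ) {ψ : (EuclideanSpace ℝ d) → (EuclideanSpace ℝ d) → ℝ} {C : ℝ}
    (hC : ∀ x v, |ψ x v| ≤ C) {t : ℝ} (ht : 0 ≤ t) (x v : (EuclideanSpace ℝ d)) :
    Summable fun n => lorentzDualTerm (Literature.Analysis.FluidPDE.Euclidean.geometry d) σ ψ n t x v :=
  (summable_abs_lorentzDualTerm hσ hC ht x v).of_abs

/-- `|P_t ψ| ≤ ‖ψ‖_∞`: the backward series of a bounded observable is bounded by the same
constant (sub-Markov property of the random flight; from the sharp factorial bound). [folklore] -/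
theorem abs_lorentzDualSeries_le {σ : ℝ} (hσ : 0 ≤ σ) {ψ : (EuclideanSpace ℝ d) → (EuclideanSpace ℝ d) → ℝ} {C : ℝ}
    (hC : ∀ x v, |ψ x v| ≤ C) {t : ℝ} (ht : 0 ≤ t) (x v : (EuclideanSpace ℝ d)) :
    |lorentzDualSeries (Literature.Analysis.FluidPDE.Euclidean.geometry d) σ ψ t x v| ≤ C := by
  rw [lorentzDualSeries_apply, ← Real.norm_eq_abs]
  have hs := summable_abs_lorentzDualTerm hσ hC ht x v
  have hs' : Summable fun n => ‖lorentzDualTerm (Literature.Analysis.FluidPDE.Euclidean.geometry d) σ ψ n t x v‖ := by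
    simpa only [Real.norm_eq_abs] using hs
  refine (norm_tsum_le_tsum_norm hs').trans ?_
  simp only [Real.norm_eq_abs]
  have hb := hasSum_dualBound C (σ * lorentzLossRate v * t)
    (mul_nonneg (mul_nonneg hσ (lorentzLossRate_nonneg v)) ht)
  calc ∑' n, |lorentzDualTerm (Literature.Analysis.FluidPDE.Euclidean.geometry d) σ ψ n t x v|
      ≤ ∑' n : ℕ, C * exp (-(σ * lorentzLossRate v * t)) * (σ * lorentzLossRate v * t) ^ n / (Nat.factorial n : ℝ) :=
        hs.tsum_le_tsum (fun n => abs_lorentzDualTerm_le hσ hC n ht x v) hb.summable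
    _ = C := hb.tsum_eq

/-- **Linearity of the backward terms in the observable** (difference form): for continuous
`ψ₁, ψ₂`, `wₙ[ψ₁ - ψ₂] = wₙ[ψ₁] - wₙ[ψ₂]` (all integrands are continuous, hence integrable on
the sphere and on `[0, t]`). [folklore] -/
theorem lorentzDualTerm_sub {σ : ℝ} {ψ₁ ψ₂ : (EuclideanSpace ℝ d) → (EuclideanSpace ℝ d) → ℝ}
    (h₁ : Continuous (Function.uncurry ψ₁)) (h₂ : Continuous (Function.uncurry ψ₂)) (n : ℕ)
    (t : ℝ) (x v : (EuclideanSpace ℝ d)) :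
    lorentzDualTerm (Literature.Analysis.FluidPDE.Euclidean.geometry d) σ (fun y w => ψ₁ y w - ψ₂ y w) n t x v =
      lorentzDualTerm (Literature.Analysis.FluidPDE.Euclidean.geometry d) σ ψ₁ n t x v -
        lorentzDualTerm (Literature.Analysis.FluidPDE.Euclidean.geometry d) σ ψ₂ n t x v := by
  induction n generalizing t x v with
  | zero => simp only [lorentzDualTerm_zero]; ring
  | succ n ih =>
    simp only [lorentzDualTerm_succ, Literature.Analysis.FluidPDE.Euclidean.geometry_translate]
    have hfun : ∀ s : ℝ, (lorentzDualTerm (Literature.Analysis.FluidPDE.Euclidean.geometry d) σ (fun y w => ψ₁ y w - ψ₂ y w) n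
        (t - s) (x + s • v)) = fun w => lorentzDualTerm (Literature.Analysis.FluidPDE.Euclidean.geometry d) σ ψ₁ n (t - s)
          (x + s • v) w - lorentzDualTerm (Literature.Analysis.FluidPDE.Euclidean.geometry d) σ ψ₂ n (t - s) (x + s • v) w :=
      fun s => funext fun w => ih (t - s) (x + s • v) w
    simp_rw [hfun]
    -- gain of a difference
    have hgain : ∀ s : ℝ, lorentzGainOp (fun w => lorentzDualTerm (Literature.Analysis.FluidPDE.Euclidean.geometry d) σ ψ₁ n
        (t - s) (x + s • v) w - lorentzDualTerm (Literature.Analysis.FluidPDE.Euclidean.geometry d) σ ψ₂ n (t - s) (x + s • v) w)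
          v = lorentzGainOp (lorentzDualTerm (Literature.Analysis.FluidPDE.Euclidean.geometry d) σ ψ₁ n (t - s) (x + s • v)) v -
            lorentzGainOp (lorentzDualTerm (Literature.Analysis.FluidPDE.Euclidean.geometry d) σ ψ₂ n (t - s) (x + s • v)) v := by
      intro s
      unfold lorentzGainOp
      simp only [mul_sub]
      exact integral_sub (integrable_gainIntegrand_of_continuous
        (continuous_lorentzDualTerm_comp h₁ n continuous_const continuous_const continuous_id') v)
        (integrable_gainIntegrand_of_continuous
        (continuous_lorentzDualTerm_comp h₂ n continuous_const continuous_const continuous_id') v)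
    simp_rw [hgain, mul_sub]
    -- interval integral of a difference
    have hc : ∀ {ψ : (EuclideanSpace ℝ d) → (EuclideanSpace ℝ d) → ℝ}, Continuous (Function.uncurry ψ) → Continuous fun s : ℝ =>
        exp (-(σ * lorentzLossRate v * s)) * (σ * lorentzGainOp
          (lorentzDualTerm (Literature.Analysis.FluidPDE.Euclidean.geometry d) σ ψ n (t - s) (x + s • v)) v) := by
      intro ψ hψ
      refine ((continuous_const.mul continuous_id).neg.rexp).mul (continuous_const.mul ?_)
      have hh : Continuous fun q : ℝ × (EuclideanSpace ℝ d) =>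
          lorentzDualTerm (Literature.Analysis.FluidPDE.Euclidean.geometry d) σ ψ n (t - q.1) (x + q.1 • v) q.2 :=
        continuous_lorentzDualTerm_comp hψ n (continuous_const.sub continuous_fst)
          (continuous_const.add (continuous_fst.smul continuous_const)) continuous_snd
      exact continuous_lorentzGainOp_param hh continuous_const
    exact intervalIntegral.integral_sub ((hc h₁).intervalIntegrable _ _)
      ((hc h₂).intervalIntegrable _ _)

/-- Linearity of the backward series in the observable (difference form), `σ ≥ 0`, `t ≥ 0`,
bounded continuous observables. [folklore] -/
theorem lorentzDualSeries_sub {σ : ℝ} (hσ : 0 ≤ σ) {ψ₁ ψ₂ : (EuclideanSpace ℝ d) → (EuclideanSpace ℝ d) → ℝ}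
    (h₁ : Continuous (Function.uncurry ψ₁)) (h₂ : Continuous (Function.uncurry ψ₂)) {C₁ C₂ : ℝ}
    (hC₁ : ∀ x v, |ψ₁ x v| ≤ C₁) (hC₂ : ∀ x v, |ψ₂ x v| ≤ C₂) {t : ℝ} (ht : 0 ≤ t) (x v : (EuclideanSpace ℝ d)) :
    lorentzDualSeries (Literature.Analysis.FluidPDE.Euclidean.geometry d) σ (fun y w => ψ₁ y w - ψ₂ y w) t x v =
      lorentzDualSeries (Literature.Analysis.FluidPDE.Euclidean.geometry d) σ ψ₁ t x v -
        lorentzDualSeries (Literature.Analysis.FluidPDE.Euclidean.geometry d) σ ψ₂ t x v := by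
  simp only [lorentzDualSeries_apply]
  rw [← (summable_lorentzDualTerm hσ hC₁ ht x v).tsum_sub (summable_lorentzDualTerm hσ hC₂ ht x v)]
  exact tsum_congr fun n => lorentzDualTerm_sub h₁ h₂ n t x v

end DualReal

/-! ## From the real terms to the `ℝ≥0∞` mirrors -/

section Transfer

variable {d : Type*} [Fintype d]


omit [Fintype d] in
/-- `ofReal` of the gain operator of a continuous nonnegative function is the `ℝ≥0∞` gain
operator of its `ofReal`. [folklore] -/
theorem ofReal_lorentzGainOp {E : Type*} [NormedAddCommGroup E] [InnerProductSpace ℝ E]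
    [FiniteDimensional ℝ E] [MeasurableSpace E] [BorelSpace E] {g : E → ℝ} (hg : Continuous g)
    (hg0 : ∀ w, 0 ≤ g w) (v : E) :
    ENNReal.ofReal (lorentzGainOp g v) = lorentzGainOpENN (fun w => ENNReal.ofReal (g w)) v := by
  unfold lorentzGainOp lorentzGainOpENN
  rw [ofReal_integral_eq_lintegral_ofReal (integrable_gainIntegrand_of_continuous hg v)
    (Eventually.of_forall fun ω => mul_nonneg (le_max_right _ _) (hg0 _))]
  refine lintegral_congr fun ω => ?_
  rw [ENNReal.ofReal_mul (le_max_right _ _)]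

/-- **T1**: for `σ ≥ 0`, continuous `f₀ ≥ 0` and `t ≥ 0`, the `ℝ≥0∞` forward term of
`ofReal ∘ f₀` is `ofReal` of the real forward term. [folklore] -/
theorem ofReal_lorentzSeriesTerm {σ : ℝ} (hσ : 0 ≤ σ) {f₀ : (EuclideanSpace ℝ d) → (EuclideanSpace ℝ d) → ℝ}
    (hf₀ : Continuous (Function.uncurry f₀)) (hf₀0 : ∀ x v, 0 ≤ f₀ x v) (n : ℕ) {t : ℝ}
    (ht : 0 ≤ t) (x v : (EuclideanSpace ℝ d)) :
    ENNReal.ofReal (lorentzSeriesTerm (Literature.Analysis.FluidPDE.Euclidean.geometry d) σ f₀ n t x v) =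
      lorentzSeriesTermENN (Literature.Analysis.FluidPDE.Euclidean.geometry d) σ (fun y w => ENNReal.ofReal (f₀ y w)) n t x v := by
  induction n generalizing t x v with
  | zero =>
    rw [lorentzSeriesTerm_zero, lorentzSeriesTermENN_zero, ENNReal.ofReal_mul (exp_pos _).le]
  | succ n ih =>
    rw [lorentzSeriesTerm_succ, lorentzSeriesTermENN_succ, intervalIntegral.integral_of_le ht]
    -- the real integrand is continuous and nonnegative on `(0, t]`
    have hF : Continuous fun s : ℝ => exp (-(σ * lorentzLossRate v * (t - s))) *
        (σ * lorentzGainOp (lorentzSeriesTerm (Literature.Analysis.FluidPDE.Euclidean.geometry d) σ f₀ n s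
          ((Literature.Analysis.FluidPDE.Euclidean.geometry d).translate x ((s - t) • v))) v) :=
      ((continuous_const.mul (continuous_const.sub continuous_id)).neg.rexp).mul
        (continuous_const.mul (continuous_lorentzGainOp_along (continuous_lorentzSeriesTerm hf₀ n)
          t x v))
    have hF0 : ∀ s ∈ Ioc (0 : ℝ) t, 0 ≤ exp (-(σ * lorentzLossRate v * (t - s))) *
        (σ * lorentzGainOp (lorentzSeriesTerm (Literature.Analysis.FluidPDE.Euclidean.geometry d) σ f₀ n s
          ((Literature.Analysis.FluidPDE.Euclidean.geometry d).translate x ((s - t) • v))) v) := fun s hs =>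
      mul_nonneg (exp_pos _).le (mul_nonneg hσ (lorentzGainOp_nonneg
        (fun w => lorentzSeriesTerm_nonneg _ hσ hf₀0 n hs.1.le _ w) v))
    rw [ofReal_integral_eq_lintegral_ofReal (hF.integrableOn_Icc.mono_set Ioc_subset_Icc_self)
      ((ae_restrict_iff' measurableSet_Ioc).2 (Eventually.of_forall hF0))]
    refine setLIntegral_congr_fun measurableSet_Ioc (fun s hs => ?_)
    have hcont : Continuous (lorentzSeriesTerm (Literature.Analysis.FluidPDE.Euclidean.geometry d) σ f₀ n s
        ((Literature.Analysis.FluidPDE.Euclidean.geometry d).translate x ((s - t) • v))) :=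
      continuous_lorentzSeriesTerm_comp hf₀ n continuous_const continuous_const continuous_id'
    rw [ENNReal.ofReal_mul (exp_pos _).le, ENNReal.ofReal_mul hσ,
      ofReal_lorentzGainOp hcont (fun w => lorentzSeriesTerm_nonneg _ hσ hf₀0 n hs.1.le _ w)]
    have hfun : (fun w => ENNReal.ofReal (lorentzSeriesTerm (Literature.Analysis.FluidPDE.Euclidean.geometry d) σ f₀ n s
        ((Literature.Analysis.FluidPDE.Euclidean.geometry d).translate x ((s - t) • v)) w)) =
        lorentzSeriesTermENN (Literature.Analysis.FluidPDE.Euclidean.geometry d) σ (fun y w => ENNReal.ofReal (f₀ y w)) n s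
          ((Literature.Analysis.FluidPDE.Euclidean.geometry d).translate x ((s - t) • v)) :=
      funext fun w => ih hs.1.le _ w
    rw [hfun]

/-- **T2**: for `σ ≥ 0`, a continuous observable `ψ ≥ 0` and `t ≥ 0`, the `ℝ≥0∞` backward term
of `ofReal ∘ ψ` is `ofReal` of the real backward term. [folklore] -/
theorem ofReal_lorentzDualTerm {σ : ℝ} (hσ : 0 ≤ σ) {ψ : (EuclideanSpace ℝ d) → (EuclideanSpace ℝ d) → ℝ}
    (hψ : Continuous (Function.uncurry ψ)) (hψ0 : ∀ x v, 0 ≤ ψ x v) (n : ℕ) {t : ℝ}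
    (ht : 0 ≤ t) (x v : (EuclideanSpace ℝ d)) :
    ENNReal.ofReal (lorentzDualTerm (Literature.Analysis.FluidPDE.Euclidean.geometry d) σ ψ n t x v) =
      lorentzDualTermENN (Literature.Analysis.FluidPDE.Euclidean.geometry d) σ (fun y w => ENNReal.ofReal (ψ y w)) n t x v := by
  induction n generalizing t x v with
  | zero =>
    rw [lorentzDualTerm_zero, lorentzDualTermENN_zero, ENNReal.ofReal_mul (exp_pos _).le]
  | succ n ih =>
    rw [lorentzDualTerm_succ, lorentzDualTermENN_succ, intervalIntegral.integral_of_le ht]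
    have hh : Continuous fun q : ℝ × (EuclideanSpace ℝ d) =>
        lorentzDualTerm (Literature.Analysis.FluidPDE.Euclidean.geometry d) σ ψ n (t - q.1)
          ((Literature.Analysis.FluidPDE.Euclidean.geometry d).translate x (q.1 • v)) q.2 :=
      continuous_lorentzDualTerm_comp hψ n (continuous_const.sub continuous_fst)
        (continuous_const.add (continuous_fst.smul continuous_const)) continuous_snd
    have hF : Continuous fun s : ℝ => exp (-(σ * lorentzLossRate v * s)) *
        (σ * lorentzGainOp (lorentzDualTerm (Literature.Analysis.FluidPDE.Euclidean.geometry d) σ ψ n (t - s)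
          ((Literature.Analysis.FluidPDE.Euclidean.geometry d).translate x (s • v))) v) :=
      ((continuous_const.mul continuous_id).neg.rexp).mul
        (continuous_const.mul (continuous_lorentzGainOp_param hh continuous_const))
    have hF0 : ∀ s ∈ Ioc (0 : ℝ) t, 0 ≤ exp (-(σ * lorentzLossRate v * s)) *
        (σ * lorentzGainOp (lorentzDualTerm (Literature.Analysis.FluidPDE.Euclidean.geometry d) σ ψ n (t - s)
          ((Literature.Analysis.FluidPDE.Euclidean.geometry d).translate x (s • v))) v) := fun s hs =>
      mul_nonneg (exp_pos _).le (mul_nonneg hσ (lorentzGainOp_nonneg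
        (fun w => lorentzDualTerm_nonneg _ hσ hψ0 n (sub_nonneg.2 hs.2) _ w) v))
    rw [ofReal_integral_eq_lintegral_ofReal (hF.integrableOn_Icc.mono_set Ioc_subset_Icc_self)
      ((ae_restrict_iff' measurableSet_Ioc).2 (Eventually.of_forall hF0))]
    refine setLIntegral_congr_fun measurableSet_Ioc (fun s hs => ?_)
    have hcont : Continuous (lorentzDualTerm (Literature.Analysis.FluidPDE.Euclidean.geometry d) σ ψ n (t - s)
        ((Literature.Analysis.FluidPDE.Euclidean.geometry d).translate x (s • v))) :=
      continuous_lorentzDualTerm_comp hψ n continuous_const continuous_const continuous_id'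
    rw [ENNReal.ofReal_mul (exp_pos _).le, ENNReal.ofReal_mul hσ,
      ofReal_lorentzGainOp hcont
        (fun w => lorentzDualTerm_nonneg _ hσ hψ0 n (sub_nonneg.2 hs.2) _ w)]
    have hfun : (fun w => ENNReal.ofReal (lorentzDualTerm (Literature.Analysis.FluidPDE.Euclidean.geometry d) σ ψ n (t - s)
        ((Literature.Analysis.FluidPDE.Euclidean.geometry d).translate x (s • v)) w)) =
        lorentzDualTermENN (Literature.Analysis.FluidPDE.Euclidean.geometry d) σ (fun y w => ENNReal.ofReal (ψ y w)) n (t - s)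
          ((Literature.Analysis.FluidPDE.Euclidean.geometry d).translate x (s • v)) :=
      funext fun w => ih (sub_nonneg.2 hs.2) _ w
    rw [hfun]

end Transfer

/-! ## Duality of the real series and the discharge of `lorentzSeries_duality` -/

section DualityReal

variable {d : Type*} [Fintype d]


/-- **Duality for a nonnegative observable**, with the integrability of both sides: for
`σ ≥ 0`, `t ≥ 0`, continuous integrable `0 ≤ f₀ ≤ M` and continuous `0 ≤ ψ ≤ C`,
`∫ ψ · (∑ₙ uₙ)(t) = ∫ f₀ · (∑ₙ wₙ)(t)`, both integrands being integrable (Tonelli on the `ℝ≥0∞`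
mirrors, `lintegral_mul_lorentzSeriesTermENN`, and the bound `∑ₙ wₙ ≤ C`). [folklore] -/
theorem integral_mul_lorentzSeriesSolution_of_nonneg {σ : ℝ} (hσ : 0 ≤ σ) {f₀ : (EuclideanSpace ℝ d) → (EuclideanSpace ℝ d) → ℝ}
    (hf₀c : Continuous (Function.uncurry f₀)) (hf₀i : Integrable (Function.uncurry f₀))
    (hf₀0 : ∀ x v, 0 ≤ f₀ x v) {M : ℝ} (hM : ∀ x v, f₀ x v ≤ M) {ψ : (EuclideanSpace ℝ d) → (EuclideanSpace ℝ d) → ℝ}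
    (hψc : Continuous (Function.uncurry ψ)) (hψ0 : ∀ x v, 0 ≤ ψ x v) {C : ℝ}
    (hC : ∀ x v, ψ x v ≤ C) {t : ℝ} (ht : 0 ≤ t) :
    Integrable (fun z : (EuclideanSpace ℝ d) × (EuclideanSpace ℝ d) => ψ z.1 z.2 *
        lorentzSeriesSolution (Literature.Analysis.FluidPDE.Euclidean.geometry d) σ f₀ t z.1 z.2) ∧
      Integrable (fun z : (EuclideanSpace ℝ d) × (EuclideanSpace ℝ d) => f₀ z.1 z.2 *
        lorentzDualSeries (Literature.Analysis.FluidPDE.Euclidean.geometry d) σ ψ t z.1 z.2) ∧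
      ∫ z : (EuclideanSpace ℝ d) × (EuclideanSpace ℝ d), ψ z.1 z.2 * lorentzSeriesSolution (Literature.Analysis.FluidPDE.Euclidean.geometry d) σ f₀ t z.1 z.2 =
        ∫ z : (EuclideanSpace ℝ d) × (EuclideanSpace ℝ d), f₀ z.1 z.2 * lorentzDualSeries (Literature.Analysis.FluidPDE.Euclidean.geometry d) σ ψ t z.1 z.2 := by
  -- absolute-value bounds
  have hMabs : ∀ x v, |f₀ x v| ≤ M := fun x v => by rw [abs_of_nonneg (hf₀0 x v)]; exact hM x v
  have hCabs : ∀ x v, |ψ x v| ≤ C := fun x v => by rw [abs_of_nonneg (hψ0 x v)]; exact hC x v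
  have hC0 : 0 ≤ C := (hψ0 0 0).trans (hC 0 0)
  -- measurability of the `ofReal` data
  have hf₀m : Measurable (Function.uncurry fun y w => ENNReal.ofReal (f₀ y w)) :=
    ENNReal.measurable_ofReal.comp hf₀c.measurable
  have hψm : Measurable (Function.uncurry fun y w => ENNReal.ofReal (ψ y w)) :=
    ENNReal.measurable_ofReal.comp hψc.measurable
  -- nonnegativity and summability of the two series
  have hS0 : ∀ z : (EuclideanSpace ℝ d) × (EuclideanSpace ℝ d), 0 ≤ lorentzSeriesSolution (Literature.Analysis.FluidPDE.Euclidean.geometry d) σ f₀ t z.1 z.2 :=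
    fun z => lorentzSeriesSolution_nonneg _ hσ hf₀0 ht _ _
  have hD0 : ∀ z : (EuclideanSpace ℝ d) × (EuclideanSpace ℝ d), 0 ≤ lorentzDualSeries (Literature.Analysis.FluidPDE.Euclidean.geometry d) σ ψ t z.1 z.2 :=
    fun z => lorentzDualSeries_nonneg _ hσ hψ0 ht _ _
  -- (i) pointwise: `ofReal (ψ S) = ∑' ψ' U'ₙ`
  have hI : ∀ z : (EuclideanSpace ℝ d) × (EuclideanSpace ℝ d), ENNReal.ofReal (ψ z.1 z.2 *
      lorentzSeriesSolution (Literature.Analysis.FluidPDE.Euclidean.geometry d) σ f₀ t z.1 z.2) =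
      ∑' n, ENNReal.ofReal (ψ z.1 z.2) * lorentzSeriesTermENN (Literature.Analysis.FluidPDE.Euclidean.geometry d) σ
        (fun y w => ENNReal.ofReal (f₀ y w)) n t z.1 z.2 := by
    intro z
    rw [ENNReal.ofReal_mul (hψ0 _ _), lorentzSeriesSolution_apply,
      ENNReal.ofReal_tsum_of_nonneg (fun n => lorentzSeriesTerm_nonneg _ hσ hf₀0 n ht _ _)
        (summable_lorentzSeriesTerm hσ hMabs t z.1 z.2), ← ENNReal.tsum_mul_left]
    exact tsum_congr fun n => by rw [ofReal_lorentzSeriesTerm hσ hf₀c hf₀0 n ht]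
  -- (ii) pointwise: `ofReal D = ∑' W'ₙ` and `ofReal (f₀ D) = ∑' W'ₙ f₀'`
  have hIID : ∀ z : (EuclideanSpace ℝ d) × (EuclideanSpace ℝ d), ENNReal.ofReal (lorentzDualSeries (Literature.Analysis.FluidPDE.Euclidean.geometry d) σ ψ t z.1 z.2) =
      ∑' n, lorentzDualTermENN (Literature.Analysis.FluidPDE.Euclidean.geometry d) σ (fun y w => ENNReal.ofReal (ψ y w)) n t
        z.1 z.2 := by
    intro z
    rw [lorentzDualSeries_apply,
      ENNReal.ofReal_tsum_of_nonneg (fun n => lorentzDualTerm_nonneg _ hσ hψ0 n ht _ _)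
        (summable_lorentzDualTerm hσ hCabs ht z.1 z.2)]
    exact tsum_congr fun n => ofReal_lorentzDualTerm hσ hψc hψ0 n ht _ _
  have hII : ∀ z : (EuclideanSpace ℝ d) × (EuclideanSpace ℝ d), ENNReal.ofReal (f₀ z.1 z.2 *
      lorentzDualSeries (Literature.Analysis.FluidPDE.Euclidean.geometry d) σ ψ t z.1 z.2) =
      ∑' n, lorentzDualTermENN (Literature.Analysis.FluidPDE.Euclidean.geometry d) σ (fun y w => ENNReal.ofReal (ψ y w)) n t
        z.1 z.2 * ENNReal.ofReal (f₀ z.1 z.2) := by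
    intro z
    rw [mul_comm, ENNReal.ofReal_mul (hD0 z), hIID, ENNReal.tsum_mul_right]
  -- measurability of the terms
  have hUm : ∀ n, Measurable fun z : (EuclideanSpace ℝ d) × (EuclideanSpace ℝ d) => ENNReal.ofReal (ψ z.1 z.2) *
      lorentzSeriesTermENN (Literature.Analysis.FluidPDE.Euclidean.geometry d) σ (fun y w => ENNReal.ofReal (f₀ y w)) n t
        z.1 z.2 := fun n => by
    have h := (measurable_lorentzSeriesTermENN (σ := σ) hf₀m n).comp
      ((measurable_const (a := t)).prodMk measurable_id)
    exact hψm.mul h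
  have hWm : ∀ n, Measurable fun z : (EuclideanSpace ℝ d) × (EuclideanSpace ℝ d) =>
      lorentzDualTermENN (Literature.Analysis.FluidPDE.Euclidean.geometry d) σ (fun y w => ENNReal.ofReal (ψ y w)) n t
        z.1 z.2 := fun n => by
    have h := (measurable_lorentzDualTermENN (σ := σ) hψm n).comp
      ((measurable_const (a := t)).prodMk measurable_id)
    exact h
  -- (iii) the lintegral identity
  have hIII : ∫⁻ z : (EuclideanSpace ℝ d) × (EuclideanSpace ℝ d), ENNReal.ofReal (ψ z.1 z.2 *
      lorentzSeriesSolution (Literature.Analysis.FluidPDE.Euclidean.geometry d) σ f₀ t z.1 z.2) =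
      ∫⁻ z : (EuclideanSpace ℝ d) × (EuclideanSpace ℝ d), ENNReal.ofReal (f₀ z.1 z.2 *
        lorentzDualSeries (Literature.Analysis.FluidPDE.Euclidean.geometry d) σ ψ t z.1 z.2) := by
    simp_rw [hI, hII]
    have hWfm : ∀ n, Measurable fun z : (EuclideanSpace ℝ d) × (EuclideanSpace ℝ d) =>
        lorentzDualTermENN (Literature.Analysis.FluidPDE.Euclidean.geometry d) σ (fun y w => ENNReal.ofReal (ψ y w)) n t
          z.1 z.2 * ENNReal.ofReal (f₀ z.1 z.2) := fun n => (hWm n).mul hf₀m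
    rw [lintegral_tsum fun n => (hUm n).aemeasurable, lintegral_tsum fun n => (hWfm n).aemeasurable]
    exact tsum_congr fun n => lintegral_mul_lorentzSeriesTermENN σ hf₀m n hψm t
  -- (iv) finiteness of the right-hand side: `0 ≤ D ≤ C`
  have hf₀m' : Measurable fun z : (EuclideanSpace ℝ d) × (EuclideanSpace ℝ d) => ENNReal.ofReal (f₀ z.1 z.2) := hf₀m
  have hfin : ∫⁻ z : (EuclideanSpace ℝ d) × (EuclideanSpace ℝ d), ENNReal.ofReal (f₀ z.1 z.2 *
      lorentzDualSeries (Literature.Analysis.FluidPDE.Euclidean.geometry d) σ ψ t z.1 z.2) < ∞ := by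
    have hle : ∀ z : (EuclideanSpace ℝ d) × (EuclideanSpace ℝ d), ENNReal.ofReal (f₀ z.1 z.2 *
        lorentzDualSeries (Literature.Analysis.FluidPDE.Euclidean.geometry d) σ ψ t z.1 z.2) ≤
        ENNReal.ofReal C * ENNReal.ofReal (f₀ z.1 z.2) := fun z => by
      rw [← ENNReal.ofReal_mul hC0]
      refine ENNReal.ofReal_le_ofReal ?_
      rw [mul_comm]
      exact mul_le_mul_of_nonneg_right
        ((le_abs_self _).trans (abs_lorentzDualSeries_le hσ hCabs ht _ _)) (hf₀0 _ _)
    refine (lintegral_mono hle).trans_lt ?_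
    rw [lintegral_const_mul _ hf₀m']
    exact ENNReal.mul_lt_top ENNReal.ofReal_lt_top hf₀i.lintegral_lt_top
  -- (v) integrability
  have hSc : Continuous fun z : (EuclideanSpace ℝ d) × (EuclideanSpace ℝ d) =>
      lorentzSeriesSolution (Literature.Analysis.FluidPDE.Euclidean.geometry d) σ f₀ t z.1 z.2 :=
    continuous_lorentzSeriesSolution_comp hσ hMabs hf₀c continuous_const continuous_fst
      continuous_snd
  have hψS0 : ∀ z : (EuclideanSpace ℝ d) × (EuclideanSpace ℝ d), 0 ≤ ψ z.1 z.2 *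
      lorentzSeriesSolution (Literature.Analysis.FluidPDE.Euclidean.geometry d) σ f₀ t z.1 z.2 :=
    fun z => mul_nonneg (hψ0 _ _) (hS0 z)
  have hfD0 : ∀ z : (EuclideanSpace ℝ d) × (EuclideanSpace ℝ d), 0 ≤ f₀ z.1 z.2 *
      lorentzDualSeries (Literature.Analysis.FluidPDE.Euclidean.geometry d) σ ψ t z.1 z.2 :=
    fun z => mul_nonneg (hf₀0 _ _) (hD0 z)
  have hψSm : AEStronglyMeasurable (fun z : (EuclideanSpace ℝ d) × (EuclideanSpace ℝ d) => ψ z.1 z.2 *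
      lorentzSeriesSolution (Literature.Analysis.FluidPDE.Euclidean.geometry d) σ f₀ t z.1 z.2) volume :=
    (hψc.mul hSc).aestronglyMeasurable
  have hDm : Measurable fun z : (EuclideanSpace ℝ d) × (EuclideanSpace ℝ d) =>
      lorentzDualSeries (Literature.Analysis.FluidPDE.Euclidean.geometry d) σ ψ t z.1 z.2 := by
    have : (fun z : (EuclideanSpace ℝ d) × (EuclideanSpace ℝ d) => lorentzDualSeries (Literature.Analysis.FluidPDE.Euclidean.geometry d) σ ψ t z.1 z.2) =
        fun z => (∑' n, lorentzDualTermENN (Literature.Analysis.FluidPDE.Euclidean.geometry d) σ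
          (fun y w => ENNReal.ofReal (ψ y w)) n t z.1 z.2).toReal :=
      funext fun z => by rw [← hIID z, ENNReal.toReal_ofReal (hD0 z)]
    rw [this]
    exact (Measurable.tsum hWm).ennreal_toReal
  have hfDm : AEStronglyMeasurable (fun z : (EuclideanSpace ℝ d) × (EuclideanSpace ℝ d) => f₀ z.1 z.2 *
      lorentzDualSeries (Literature.Analysis.FluidPDE.Euclidean.geometry d) σ ψ t z.1 z.2) volume :=
    (hf₀c.measurable.mul hDm).aestronglyMeasurable
  have IψS : Integrable (fun z : (EuclideanSpace ℝ d) × (EuclideanSpace ℝ d) => ψ z.1 z.2 *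
      lorentzSeriesSolution (Literature.Analysis.FluidPDE.Euclidean.geometry d) σ f₀ t z.1 z.2) :=
    ⟨hψSm, (hasFiniteIntegral_iff_ofReal (Eventually.of_forall hψS0)).2 (by rw [hIII]; exact hfin)⟩
  have IfD : Integrable (fun z : (EuclideanSpace ℝ d) × (EuclideanSpace ℝ d) => f₀ z.1 z.2 *
      lorentzDualSeries (Literature.Analysis.FluidPDE.Euclidean.geometry d) σ ψ t z.1 z.2) :=
    ⟨hfDm, (hasFiniteIntegral_iff_ofReal (Eventually.of_forall hfD0)).2 hfin⟩
  refine ⟨IψS, IfD, ?_⟩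
  -- (vi) the Bochner integrals
  rw [integral_eq_lintegral_of_nonneg_ae (Eventually.of_forall hψS0) hψSm,
    integral_eq_lintegral_of_nonneg_ae (Eventually.of_forall hfD0) hfDm, hIII]

/-- **Discharge of F3b** (`Kinetic.lorentzSeries_duality`): `∫ φ · (∑ₙ uₙ)(t) = ∫ f₀ · (∑ₙ wₙ)(t)`
for `σ ≥ 0`, `t ≥ 0`, continuous bounded integrable `f₀ ≥ 0` and bounded continuous `φ`. The
observable is split into its positive and negative parts, to which
`integral_mul_lorentzSeriesSolution_of_nonneg` applies, and the backward series is linear in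
the observable (`lorentzDualSeries_sub`). [cite: Spohn1978, §3 and Thm 3] -/
theorem lorentzSeries_duality_holds : lorentzSeries_duality (d := d) := by
  intro σ hσ f₀ hf₀ hf₀' hf₀0 hf₀b θ hθ hθb t ht
  obtain ⟨M, hM⟩ := hf₀b
  obtain ⟨C, hC⟩ := hθb
  -- the curried datum
  have hgc : Continuous (Function.uncurry (Function.curry f₀)) := by
    rwa [Function.uncurry_curry]
  have hgi : Integrable (Function.uncurry (Function.curry f₀)) := by
    rwa [Function.uncurry_curry]
  have hg0 : ∀ x v, 0 ≤ Function.curry f₀ x v := fun x v => hf₀0 (x, v)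
  have hgM : ∀ x v, Function.curry f₀ x v ≤ M := fun x v => hM (x, v)
  -- positive and negative parts of the observable
  have hθc' : Continuous fun z : (EuclideanSpace ℝ d) × (EuclideanSpace ℝ d) => θ (z.1, z.2) := by simpa using hθ
  have hpc : Continuous (Function.uncurry fun (x : (EuclideanSpace ℝ d)) (v : (EuclideanSpace ℝ d)) => max (θ (x, v)) 0) :=
    hθc'.max continuous_const
  have hnc : Continuous (Function.uncurry fun (x : (EuclideanSpace ℝ d)) (v : (EuclideanSpace ℝ d)) => max (-θ (x, v)) 0) :=
    hθc'.neg.max continuous_const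
  have hp0 : ∀ (x : (EuclideanSpace ℝ d)) (v : (EuclideanSpace ℝ d)), 0 ≤ max (θ (x, v)) 0 := fun _ _ => le_max_right _ _
  have hn0 : ∀ (x : (EuclideanSpace ℝ d)) (v : (EuclideanSpace ℝ d)), 0 ≤ max (-θ (x, v)) 0 := fun _ _ => le_max_right _ _
  have hpC : ∀ (x : (EuclideanSpace ℝ d)) (v : (EuclideanSpace ℝ d)), max (θ (x, v)) 0 ≤ C := fun x v =>
    max_le ((le_abs_self _).trans (hC _)) ((abs_nonneg _).trans (hC (x, v)))
  have hnC : ∀ (x : (EuclideanSpace ℝ d)) (v : (EuclideanSpace ℝ d)), max (-θ (x, v)) 0 ≤ C := fun x v =>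
    max_le ((neg_le_abs _).trans (hC _)) ((abs_nonneg _).trans (hC (x, v)))
  have hpCabs : ∀ (x : (EuclideanSpace ℝ d)) (v : (EuclideanSpace ℝ d)), |max (θ (x, v)) 0| ≤ C := fun x v => by
    rw [abs_of_nonneg (hp0 x v)]; exact hpC x v
  have hnCabs : ∀ (x : (EuclideanSpace ℝ d)) (v : (EuclideanSpace ℝ d)), |max (-θ (x, v)) 0| ≤ C := fun x v => by
    rw [abs_of_nonneg (hn0 x v)]; exact hnC x v
  obtain ⟨Ip, Jp, Ep⟩ := integral_mul_lorentzSeriesSolution_of_nonneg hσ hgc hgi hg0 hgM hpc hp0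
    hpC ht
  obtain ⟨In, Jn, En⟩ := integral_mul_lorentzSeriesSolution_of_nonneg hσ hgc hgi hg0 hgM hnc hn0
    hnC ht
  -- decompositions
  have hcurry : Function.curry θ = fun (x : (EuclideanSpace ℝ d)) (v : (EuclideanSpace ℝ d)) => max (θ (x, v)) 0 - max (-θ (x, v)) 0 := by
    funext x v
    rw [Function.curry_apply, max_zero_sub_max_neg_zero_eq_self]
  have hDdec : ∀ z : (EuclideanSpace ℝ d) × (EuclideanSpace ℝ d), lorentzDualSeries (Literature.Analysis.FluidPDE.Euclidean.geometry d) σ (Function.curry θ) t z.1 z.2 =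
      lorentzDualSeries (Literature.Analysis.FluidPDE.Euclidean.geometry d) σ (fun x v => max (θ (x, v)) 0) t z.1 z.2 -
        lorentzDualSeries (Literature.Analysis.FluidPDE.Euclidean.geometry d) σ (fun x v => max (-θ (x, v)) 0) t z.1 z.2 :=
    fun z => by
      rw [hcurry]
      exact lorentzDualSeries_sub hσ hpc hnc hpCabs hnCabs ht _ _
  have hL : ∀ z : (EuclideanSpace ℝ d) × (EuclideanSpace ℝ d), θ z * lorentzSeriesSolution (Literature.Analysis.FluidPDE.Euclidean.geometry d) σ (Function.curry f₀)
      t z.1 z.2 = max (θ (z.1, z.2)) 0 * lorentzSeriesSolution (Literature.Analysis.FluidPDE.Euclidean.geometry d) σ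
        (Function.curry f₀) t z.1 z.2 - max (-θ (z.1, z.2)) 0 *
          lorentzSeriesSolution (Literature.Analysis.FluidPDE.Euclidean.geometry d) σ (Function.curry f₀) t z.1 z.2 := fun z => by
    rw [← sub_mul, max_zero_sub_max_neg_zero_eq_self]
  have hR : ∀ z : (EuclideanSpace ℝ d) × (EuclideanSpace ℝ d), f₀ z * lorentzDualSeries (Literature.Analysis.FluidPDE.Euclidean.geometry d) σ (Function.curry θ) t
      z.1 z.2 = Function.curry f₀ z.1 z.2 * lorentzDualSeries (Literature.Analysis.FluidPDE.Euclidean.geometry d) σ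
        (fun x v => max (θ (x, v)) 0) t z.1 z.2 - Function.curry f₀ z.1 z.2 *
          lorentzDualSeries (Literature.Analysis.FluidPDE.Euclidean.geometry d) σ (fun x v => max (-θ (x, v)) 0) t z.1 z.2 :=
    fun z => by rw [hDdec, mul_sub]; rfl
  simp_rw [hL, hR]
  rw [integral_sub Ip In, integral_sub Jp Jn, Ep, En]

end DualityReal

end Kinetic

end

end Literature.MathematicalPhysics.KineticTheory
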